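import Literature.Probability.RandomPlanarGeometry.HexSAWSurfaceFreeStart
import Literature.Probability.RandomPlanarGeometry.HexSAWBrickWallStripFugacityLevel0
import Literature.Probability.RandomPlanarGeometry.HexSAWStripSurfaceLimit
import Literature.Probability.RandomPlanarGeometry.HexSAWSurfaceYcProp5Riders
import Literature.Probability.RandomPlanarGeometry.HexSAWTheorem1
import HarnessLib

/-!
# An explicit strip-locality rate for the surface growth rate of honeycomb self-avoiding walks,
# at every fugacity

One-module edition of the door «S7-RATE-ALL-Y», Parts B1–E (pub-sawmu, a-idea-1 gen 25–26), built on Part A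
`HexSAWSurfaceFreeStart` (free-start classes `fcls`, weights `HF`, the free-start maximum `Hhat` and
`surfaceMu_pow_le_Hhat`, `exists_pow_le_HF`), the tree's level-`0` strip model `HexSAWBrickWallStripFugacityLevel0`
(`stripPairs`, `bottomVisits₀`, `stripZ₀ = C_{T,N}(y,1)`, `stripMuY₀ = μ_T(y,1)`), `HexSAWStripSurfaceLimit`
(S7: `stripMuY₀_le_surfaceMu`), `HexSAWSurfaceYcProp5Riders` (`HV.surfaceMu_le_sqrt_mul`, `HV.surfaceMu_eq_of_le`)
and `HexSAWTheorem1` (`μ = √(2+√2)`).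

Beaton, Bousquet-Mélou, de Gier, Duminil-Copin and Guttmann prove that the growth rate `μ_T(y) = μ_T(y,1)` of the
surface model confined to the strip of height `T` converges to the surface growth rate `μ(y) = HV.surfaceMu y` as
`T → ∞` (§3.2, Proposition 7), with no rate.  This module makes the convergence QUANTITATIVE at every fugacity
`y > 0` — in particular throughout the adsorbed phase `y > y_c = 1 + √2`, where `μ(y) > μ` and the desorbed-phase
argument of the tree's `abs_log_sub_log_stripMuY₀_le` (valid for `y ≤ 1`) is not available:

* **`abs_log_surfaceMu_sub_log_stripMuY₀_le_of_nine_le`** (Part E) — for every `y > 0` and every `T ≥ 9`,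
  `|log μ(y) - log μ_T(y,1)| ≤ (14 √T + 4 log T + 4 |log y| + 6) / T`;
  **`abs_log_surfaceMu_sub_log_stripMuY₀_le_div_sqrt`** — `… ≤ (22 + 2 |log y|) / √T`;
* **`surfaceMu_mem_Icc_stripMuY₀`** (Part E) — the enclosure of `μ(y)` by ONE finite-strip quantity with a computable
  width, `μ_T(y,1) ≤ μ(y) ≤ μ_T(y,1) · exp ((14 √T + 4 log T + 4 |log y| + 6) / T)`;
* **`abs_log_Hhat_div_sub_log_surfaceMu_le'`** (Parts D–E) — an explicit Hammersley–Welsh rate for the free-start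
  enumeration data at every fugacity, `|log Ĥ_{2j}(y)/(2j) - log μ(y)| ≤ (6 √(2j) + log (2·2j+1) + |log y| + 3/2) / (2j)`
  (`j ≥ 1`), and the enclosure `surfaceMu_le_Hhat_rpow` / `rpow_le_surfaceMu` of `μ(y)` by `Ĥ_{2j}(y)` alone.

The mechanism (Parts B1–C, stated with the `μ(y)`-dependent constants in `log_surfaceMu_sub_log_stripMuY₀_le`):
Part A's most popular free-start class of length `2j` is UNFOLDED into x-bridges (`e^{6√n}`, Hammersley–Welsh) and
PINNED to one end ordinate (`2n+1`); two pinned bridges are MIRROR-JOINED into a loop that returns to ordinate `0`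
(time reversal of Part I of the tree's surface-bridge development); loops are CHAINED by two-step junctions and the
chain is carried by a glide reflection into the strip `S_T`, `T = 6j+3`, with its surface visits landing on the
printed level-`0` vertices — so `μ_T(y,1)^{4j+4} ≳ min(y,1)² μ(y)^{4j} / (e^{6√(2j)} (4j+1))²`, which is the rate.
Every constant is explicit and elementary; none is claimed sharp (the conjectured true defect is `T^{-1/ν}`-like;
no numerics of record are used or produced).

Sources: the strip approximation of the surface model [BeatonBousquetMelouDeGierDuminilCopinGuttmann2014, §3.1
Proposition 5 and the remark after it (arXiv v5 p. 9), §3.2 Propositions 6–7 (arXiv v5 pp. 10–12)]; unfolding and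
its `e^{O(√n)}` entropy bound [HammersleyWelsh1962, Theorem; MadrasSlade1993, §3.1, Theorem 3.1.1 (pp. 57–61)];
surface bridges / loops, junction concatenation and time reversal [HammersleyTorrieWhittington1982, §2]; most-popular
class arguments [JansevanRensburg2000, §5.4 (1st ed. pp. 167–170, §5.4.1 Theorem 5.52)]; Fekete [MadrasSlade1993,
§1.2 (1.2.15)]; `μ = √(2+√2)` via the tree's `HexSAWTheorem1`.  The explicit finite-`T` inequalities are lane
statements assembled from these (NEW-IN-WRITING candidate, modest).  Edition note: the code of Parts B1, B2, C, D, E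
below is, line for line, that of the separately celled HOME cars 16–20 of gen 25 (shas in the section headers);
only the module layout (one import block, one namespace) and the docstrings' cross-references were merged.
-/

open Finset Filter Function
open Literature.Probability.LatticeModels Literature.Probability.Percolation SimpleGraph
open Literature.Combinatorics.Enumerative
open _root_.Topology

noncomputable section

namespace Literature.Probability.RandomPlanarGeometry.SAW.HexBW.Wall

variable {n : ℕ} {ω : ℕ → Site 2} {y : ℝ}

/-! ## Part B1 — Free-start surface x-bridges: unfolding the most popular class
(code of HOME car 16 `HexSAWSurfaceFreeStartBridges_ed4_75e274978aab741d.lean`, sha16 `75e274978aab741d`)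

Part A produced, for every `y > 0` and every `j`, a starting distance `h ≤ 2j+1` of the surface in the canonical
class `(q, s) = (0, 1)` (surface above, even-time visits) whose weighted count `HF 0 1 h (2j) y` is at least
`μ(y)^{2j}`.  Here free-start classes are UNFOLDED into x-bridges at the price `e^{6√n}` and PINNED to one end
ordinate at the price `2n+1` (all lemmas for a general class `(q, s)`, the final one for the canonical class):

* `fbr s h n` = the members of `fcls s h n` that are x-bridges (`IsWB n`: `X_0 ≤ X_i ≤ X_n`), weight `HB q s h n y`;
  `fbrE s h n e` = those ending at ordinate `Y_n = e`, weight `HBE q s h n e y`;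
* `HF_le_exp_mul_HB` — **`HF q s h n y ≤ e^{6√n} · HB q s h n y`** (`n` even, `y ≥ 0`): Part I's tree-unfolding `G`
  (`G_spec`: an x-bridge with the SAME ordinates, hence the same side constraint and the same visits;
  `card_le_exp_mul_card_image_G`: fibres of size `≤ e^{6√n}`), applied level set by level set of the weight;
* `HB_le_mul_HBE` — pigeonhole on the end ordinate `Y_n ∈ [-n, n]`: some `e` has `HB ≤ (2n+1) · HBE … e`;
* `exists_pow_le_HBE` — **for every `y > 0` and `j` there are `0 ≤ h ≤ 2j+1` and `e` with
  `μ(y)^{2j} ≤ e^{6√(2j)} · (2·(2j)+1) · HBE 0 1 h (2j) e y`**.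
-/

/-- `visitsAt q s c n ω ≤ n`. [cite: BeatonBousquetMelouDeGierDuminilCopinGuttmann2014, §3.1 (arXiv v5 p. 8)] -/
theorem visitsAt_le (q : ℕ) (s c : ℤ) (n : ℕ) (ω : ℕ → Site 2) : visitsAt q s c n ω ≤ n := by
  induction n with
  | zero => simp
  | succ n ih => rw [visitsAt_succ]; split_ifs <;> omega

/-! ### Free-start x-bridges -/

open Classical in
/-- Free-start x-bridges: members of `fcls s h n` with `X_0 ≤ X_i ≤ X_n`. [cite: HammersleyWelsh1962, Theorem (bridges); JansevanRensburg2000, §5.4 (1st ed. pp. 167–168)] -/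
def fbr (s h : ℤ) (n : ℕ) : Finset (ℕ → Site 2) := (fcls s h n).filter (IsWB n)

/-- Membership in `fbr`. [cite: HammersleyWelsh1962, Theorem] -/
theorem mem_fbr {s h : ℤ} : ω ∈ fbr s h n ↔ ω ∈ fcls s h n ∧ IsWB n ω := by
  classical
  exact Finset.mem_filter

/-- `fbr s h n ⊆ fcls s h n`. [cite: HammersleyWelsh1962, Theorem] -/
theorem fbr_subset (s h : ℤ) (n : ℕ) : fbr s h n ⊆ fcls s h n := fun _ hω => (mem_fbr.1 hω).1

/-- Weight of the free-start x-bridges. [cite: JansevanRensburg2000, §5.4 (1st ed. pp. 167–168); HammersleyWelsh1962, Theorem] -/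
def HB (q : ℕ) (s h : ℤ) (n : ℕ) (y : ℝ) : ℝ := ∑ ω ∈ fbr s h n, y ^ visitsAt q s h n ω

/-- `0 ≤ HB` (`y ≥ 0`). [cite: JansevanRensburg2000, §5.4 (1st ed. pp. 167–168)] -/
theorem HB_nonneg (q : ℕ) (s h : ℤ) (n : ℕ) (hy : 0 ≤ y) : 0 ≤ HB q s h n y :=
  Finset.sum_nonneg fun _ _ => pow_nonneg hy _

/-- `HB ≤ HF` (`y ≥ 0`). [cite: JansevanRensburg2000, §5.4 (1st ed. pp. 167–168)] -/
theorem HB_le_HF (q : ℕ) (s h : ℤ) (n : ℕ) (hy : 0 ≤ y) : HB q s h n y ≤ HF q s h n y :=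
  Finset.sum_le_sum_of_subset_of_nonneg (fbr_subset s h n) fun _ _ _ => pow_nonneg hy _

/-- The tree-unfolding `G` of Part I maps a free-start walk to a free-start x-bridge of the same class with the same
visits (it preserves every ordinate). [cite: HammersleyWelsh1962, Theorem; MadrasSlade1993, §3.1, Theorem 3.1.1 (pp. 57–61)] -/
theorem G_mem_fbr (q : ℕ) {s h : ℤ} (hω : ω ∈ fcls s h n) (hn : n % 2 = 0) :
    G n ω ∈ fbr s h n ∧ visitsAt q s h n (G n ω) = visitsAt q s h n ω := by
  obtain ⟨hωs, hreg⟩ := mem_fcls.1 hω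
  obtain ⟨hG, hwb, hY⟩ := G_spec hωs hn
  exact ⟨mem_fbr.2 ⟨mem_fcls.2 ⟨hG, fun i hi => by rw [hY i hi]; exact hreg i hi⟩, hwb⟩,
    visitsAt_congr fun i _ hi => by rw [hY i hi]⟩

/-- **Weighted unfolding: `HF q s h n y ≤ e^{6√n} · HB q s h n y`** (`n` even, `y ≥ 0`).
[cite: HammersleyWelsh1962, Theorem; MadrasSlade1993, §3.1, Theorem 3.1.1 (pp. 57–61); JansevanRensburg2000, §5.4 (1st ed. pp. 167–170)] -/
theorem HF_le_exp_mul_HB (q : ℕ) (s h : ℤ) (hn : n % 2 = 0) (hy : 0 ≤ y) :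
    HF q s h n y ≤ Real.exp (6 * Real.sqrt n) * HB q s h n y := by
  classical
  have hfF : ∀ ω ∈ fcls s h n, visitsAt q s h n ω ∈ range (n + 1) := fun ω _ =>
    Finset.mem_range.2 (Nat.lt_succ_of_le (visitsAt_le q s h n ω))
  have hfB : ∀ ω ∈ fbr s h n, visitsAt q s h n ω ∈ range (n + 1) := fun ω _ =>
    Finset.mem_range.2 (Nat.lt_succ_of_le (visitsAt_le q s h n ω))
  rw [HF, HB, ← Finset.sum_fiberwise_of_maps_to hfF, ← Finset.sum_fiberwise_of_maps_to hfB, Finset.mul_sum]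
  refine Finset.sum_le_sum fun v _ => ?_
  set FA := (fcls s h n).filter (fun ω => visitsAt q s h n ω = v)
  set FW := (fbr s h n).filter (fun ω => visitsAt q s h n ω = v)
  have hA : ∑ ω ∈ FA, y ^ visitsAt q s h n ω = #FA * y ^ v := by
    rw [Finset.sum_congr rfl fun ω hω => by rw [(Finset.mem_filter.1 hω).2], Finset.sum_const, nsmul_eq_mul]
  have hW : ∑ ω ∈ FW, y ^ visitsAt q s h n ω = #FW * y ^ v := by
    rw [Finset.sum_congr rfl fun ω hω => by rw [(Finset.mem_filter.1 hω).2], Finset.sum_const, nsmul_eq_mul]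
  rw [hA, hW]
  have hT : FA ⊆ saws n := (Finset.filter_subset _ _).trans (fcls_subset s h n)
  have himg : FA.image (G n) ⊆ FW := by
    intro ζ hζ
    obtain ⟨ω, hω, rfl⟩ := Finset.mem_image.1 hζ
    obtain ⟨hωa, hv⟩ := Finset.mem_filter.1 hω
    obtain ⟨h1, h2⟩ := G_mem_fbr q hωa hn
    exact Finset.mem_filter.2 ⟨h1, by rw [h2, hv]⟩
  have h1 := card_le_exp_mul_card_image_G hT hn
  have h2 : (#(FA.image (G n)) : ℝ) ≤ #FW := by exact_mod_cast Finset.card_le_card himg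
  calc (#FA : ℝ) * y ^ v ≤ (Real.exp (6 * Real.sqrt n) * #FW) * y ^ v := by
        refine mul_le_mul_of_nonneg_right (h1.trans ?_) (pow_nonneg hy _)
        exact mul_le_mul_of_nonneg_left h2 (Real.exp_nonneg _)
    _ = Real.exp (6 * Real.sqrt n) * (#FW * y ^ v) := by ring

/-! ### Pinning the end ordinate -/

open Classical in
/-- Free-start x-bridges with end ordinate `Y_n = e`. [cite: JansevanRensburg2000, §5.4 (1st ed. pp. 167–170: walks ending at a prescribed height)] -/
def fbrE (s h : ℤ) (n : ℕ) (e : ℤ) : Finset (ℕ → Site 2) := (fbr s h n).filter (fun ω => ω n 1 = e)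

/-- Membership in `fbrE`. [cite: JansevanRensburg2000, §5.4 (1st ed. pp. 167–170)] -/
theorem mem_fbrE {s h e : ℤ} : ω ∈ fbrE s h n e ↔ ω ∈ fbr s h n ∧ ω n 1 = e := by
  classical
  exact Finset.mem_filter

/-- Their weight `HBE q s h n e y`. [cite: JansevanRensburg2000, §5.4 (1st ed. pp. 167–170)] -/
def HBE (q : ℕ) (s h : ℤ) (n : ℕ) (e : ℤ) (y : ℝ) : ℝ := ∑ ω ∈ fbrE s h n e, y ^ visitsAt q s h n ω

/-- `0 ≤ HBE` (`y ≥ 0`). [cite: JansevanRensburg2000, §5.4 (1st ed. pp. 167–170)] -/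
theorem HBE_nonneg (q : ℕ) (s h : ℤ) (n : ℕ) (e : ℤ) (hy : 0 ≤ y) : 0 ≤ HBE q s h n e y :=
  Finset.sum_nonneg fun _ _ => pow_nonneg hy _

/-- `HBE ≤ HB` (`y ≥ 0`). [cite: JansevanRensburg2000, §5.4 (1st ed. pp. 167–170)] -/
theorem HBE_le_HB (q : ℕ) (s h : ℤ) (n : ℕ) (e : ℤ) (hy : 0 ≤ y) : HBE q s h n e y ≤ HB q s h n y := by
  classical
  exact Finset.sum_le_sum_of_subset_of_nonneg (Finset.filter_subset _ _) fun _ _ _ => pow_nonneg hy _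

/-- The end ordinate lies in `[-n, n]`, so `HB = Σ_{e ∈ [-n,n]} HBE e`. [cite: MadrasSlade1993, §1.1; JansevanRensburg2000, §5.4 (1st ed. pp. 167–170)] -/
theorem HB_eq_sum_HBE (q : ℕ) (s h : ℤ) (n : ℕ) (y : ℝ) :
    HB q s h n y = ∑ e ∈ Finset.Icc (-(n : ℤ)) n, HBE q s h n e y := by
  classical
  have hf : ∀ ω ∈ fbr s h n, ω n 1 ∈ Finset.Icc (-(n : ℤ)) n := fun ω hω => by
    have := abs_le.1 (absY_le ((fcls_subset s h n) (fbr_subset s h n hω)) le_rfl)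
    exact Finset.mem_Icc.2 ⟨this.1, this.2⟩
  rw [HB, ← Finset.sum_fiberwise_of_maps_to hf]
  rfl

/-- **Pigeonhole on the end ordinate**: some `e ∈ [-n, n]` has `HB q s h n y ≤ (2n+1) · HBE q s h n e y` (the largest term).
[cite: JansevanRensburg2000, §5.4 (1st ed. pp. 167–170: the most popular height)] -/
theorem HB_le_mul_HBE (q : ℕ) (s h : ℤ) (n : ℕ) (y : ℝ) :
    ∃ e ∈ Finset.Icc (-(n : ℤ)) n, HB q s h n y ≤ (2 * n + 1) * HBE q s h n e y := by
  set I := Finset.Icc (-(n : ℤ)) n with hI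
  have hne : I.Nonempty := ⟨0, Finset.mem_Icc.2 ⟨by omega, by omega⟩⟩
  obtain ⟨e, he, hmax⟩ := Finset.exists_mem_eq_sup' hne (fun e => HBE q s h n e y)
  refine ⟨e, he, ?_⟩
  have hcard : (#I : ℝ) = 2 * n + 1 := by
    have h1 : #I = 2 * n + 1 := by
      rw [hI, Int.card_Icc]
      have e1 : (n : ℤ) + 1 - -(n : ℤ) = ((2 * n + 1 : ℕ) : ℤ) := by push_cast; ring
      rw [e1, Int.toNat_natCast]
    rw [h1]; push_cast; ring
  calc HB q s h n y = ∑ e' ∈ I, HBE q s h n e' y := HB_eq_sum_HBE q s h n y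
    _ ≤ ∑ e' ∈ I, HBE q s h n e y :=
        Finset.sum_le_sum fun e' he' => by rw [← hmax]; exact Finset.le_sup' (fun e => HBE q s h n e y) he'
    _ = (2 * n + 1) * HBE q s h n e y := by rw [Finset.sum_const, nsmul_eq_mul, hcard]

/-- **One pinned class of canonical free-start x-bridges carries the surface growth rate**: for every `y > 0`
and `j` there are `0 ≤ h ≤ 2j+1` and `e ∈ [-2j, 2j]` with
`μ(y)^{2j} ≤ e^{6√(2j)} · (2·(2j)+1) · HBE 0 1 h (2j) e y` (surface above, even-time visits — the class of
Parts I–II). [cite: JansevanRensburg2000, §5.4 (1st ed. pp. 167–170); HammersleyWelsh1962, Theorem; BeatonBousquetMelouDeGierDuminilCopinGuttmann2014, §3.1, Proposition 5 (arXiv v5 p. 9)] -/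
theorem exists_pow_le_HBE (hy : 0 < y) (j : ℕ) :
    ∃ h : ℤ, 0 ≤ h ∧ h ≤ 2 * j + 1 ∧ ∃ e ∈ Finset.Icc (-(2 * j : ℕ) : ℤ) (2 * j : ℕ),
      HV.surfaceMu y ^ (2 * j) ≤ Real.exp (6 * Real.sqrt (2 * j : ℕ)) * ((2 * (2 * j : ℕ) + 1) * HBE 0 1 h (2 * j) e y) := by
  obtain ⟨h, h0, h1, hpow⟩ := exists_pow_le_HF hy j
  have hn : (2 * j) % 2 = 0 := by omega
  obtain ⟨e, he, hpig⟩ := HB_le_mul_HBE 0 1 h (2 * j) y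
  refine ⟨h, h0, h1, e, he, ?_⟩
  calc HV.surfaceMu y ^ (2 * j) ≤ HF 0 1 h (2 * j) y := hpow
    _ ≤ Real.exp (6 * Real.sqrt (2 * j : ℕ)) * HB 0 1 h (2 * j) y := HF_le_exp_mul_HB 0 1 h hn hy.le
    _ ≤ Real.exp (6 * Real.sqrt (2 * j : ℕ)) * ((2 * (2 * j : ℕ) + 1) * HBE 0 1 h (2 * j) e y) :=
        mul_le_mul_of_nonneg_left hpig (Real.exp_nonneg _)

/-! ## Part B2 — Free-start surface loops: the mirror join
(code of HOME car 17 `HexSAWSurfaceFreeStartLoops_ed1_0f4116bcb5fa1eef.lean`, sha16 `0f4116bcb5fa1eef`)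

Two free-start x-bridges `ω, ω'` of the SAME pinned class `fbrE s h n e` (length `n` even, all ordinates with
`s·Y ≤ h`, end ordinate `e`, `X_0 ≤ X_i ≤ X_n`) are joined into ONE free-start x-bridge of length `2n+2` that
RETURNS TO ORDINATE `0`: `ω`, then the two-step junction `E → E+e₀ → E+2e₀`, then the translate of the brick-wall
time reversal `revN n ω'` of Part I (`X_i ↦ X_n − X_{n−i}`, `Y_i ↦ Y_{n−i} − Y_n`), which descends from ordinate `e`
back to `0` through the SAME ordinates as `ω'` (in reverse order), hence inside the same region and with the same
surface visits up to one unit: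

* `visitsAt_eq_sum`, `visitsAt_revN` — closed form of the visit count and its behaviour under `revN`;
* `tailPiece_spec_isWB` — Part I's junction piece for a general x-bridge;
* `mloop n ω ω' := jcat n ω (revN n ω')`; `mloop_mem` — **`mloop n ω ω' ∈ fbrE s h (n+(2+n)) 0`**;
  `visitsAt_mloop` — `v(ω) + v(ω') ≤ v(mloop) ≤ v(ω) + v(ω') + 1` for every parity class `q` and level `h`;
* `mul_HBE_sq_le` — **`min y 1 · HBE q s h n e y ^ 2 ≤ HBE q s h (n+(2+n)) 0 y`** (`n` even, `y ≥ 0`; the join is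
  injective by `Zd.concatWalk_injective_pieces`, `tailPiece_injective` and the involution `revN_revN`);
* `exists_pow_le_HBE_zero` — with Part B1: **for every `y > 0` and `j` there is `0 ≤ h ≤ 2j+1` with
  `min y 1 · μ(y)^{4j} ≤ (e^{6√(2j)} (2·2j+1))² · HBE 0 1 h (2j+(2+2j)) 0 y`**.
-/

/-! ### Closed form and time reversal of the visit count -/

/-- Closed form: `visitsAt q s c n ω = Σ_{i<n} [ (i+1) % 2 = q ∧ s·Y_{i+1} = c ]`.
[cite: BeatonBousquetMelouDeGierDuminilCopinGuttmann2014, §3.1 (arXiv v5 p. 8: number of surface contacts)] -/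
theorem visitsAt_eq_sum (q : ℕ) (s c : ℤ) (n : ℕ) (ω : ℕ → Site 2) :
    visitsAt q s c n ω = ∑ i ∈ range n, (if (i + 1) % 2 = q ∧ s * ω (i + 1) 1 = c then 1 else 0) := by
  induction n with
  | zero => simp
  | succ n ih => rw [visitsAt_succ, ih, Finset.sum_range_succ]

/-- **Visits under the brick-wall time reversal `revN`** (`n` even): counting the reversed walk over times `1..n`
at the shifted level `c − s·Y_n` is counting the original over times `0..n−1` at level `c`.
[cite: MadrasSlade1993, §3.1 (proof of Theorem 3.1.1: the reversed walk); HammersleyTorrieWhittington1982, §2] -/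
theorem visitsAt_revN (q : ℕ) (s c : ℤ) (hn : n % 2 = 0) (ω : ℕ → Site 2) :
    visitsAt q s (c - s * ω n 1) n (revN n ω) + (if n % 2 = q ∧ s * ω n 1 = c then 1 else 0) =
      visitsAt q s c n ω + (if 0 % 2 = q ∧ s * ω 0 1 = c then 1 else 0) := by
  set Q : ℕ → ℕ := fun i => if i % 2 = q ∧ s * ω i 1 = c then 1 else 0 with hQ
  have hT1 : ∑ i ∈ range (n + 1), Q i = visitsAt q s c n ω + Q 0 := by
    rw [Finset.sum_range_succ', visitsAt_eq_sum]
  have hT2 : ∑ i ∈ range (n + 1), Q i = ∑ i ∈ range n, Q i + Q n := Finset.sum_range_succ _ _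
  have hrev : visitsAt q s (c - s * ω n 1) n (revN n ω) = ∑ i ∈ range n, Q i := by
    rw [visitsAt_eq_sum, ← Finset.sum_range_reflect Q n]
    refine Finset.sum_congr rfl fun i hi => ?_
    have hi' := Finset.mem_range.1 hi
    have e1 : n - (i + 1) = n - 1 - i := by omega
    have e2 : ((i + 1) % 2 = q) ↔ ((n - 1 - i) % 2 = q) := by omega
    have e3 : (s * (ω (n - 1 - i) 1 - ω n 1) = c - s * ω n 1) ↔ (s * ω (n - 1 - i) 1 = c) := by
      constructor <;> intro h <;> linear_combination h
    simp only [hQ, revN_apply_one, e1, e2, e3]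
  change visitsAt q s (c - s * ω n 1) n (revN n ω) + Q n = visitsAt q s c n ω + Q 0
  rw [hrev, ← hT2, hT1]

/-- The first two steps: `visitsAt q s c 2 ξ = [1 = q ∧ s·Y_1 = c] + [0 = q ∧ s·Y_2 = c]`.
[cite: BeatonBousquetMelouDeGierDuminilCopinGuttmann2014, §3.1 (arXiv v5 p. 8)] -/
theorem visitsAt_two (q : ℕ) (s c : ℤ) (ξ : ℕ → Site 2) :
    visitsAt q s c 2 ξ = (if 1 = q ∧ s * ξ 1 1 = c then 1 else 0) + (if 0 = q ∧ s * ξ 2 1 = c then 1 else 0) := by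
  change visitsAt q s c (0 + 1 + 1) ξ = _
  rw [visitsAt_succ, visitsAt_succ, visitsAt_zero]
  norm_num

/-! ### The junction piece of a general x-bridge -/

/-- Part I's tail piece `0 → e₀ → 2e₀ → 2e₀ + υ` for a general brick-wall x-bridge `υ` (the `IsWB` form of
`HexSAWSurfaceWallRateEq.tailPiece_spec'`, kept self-contained so that this rider does not import that module): a
brick-wall SAW of length `2 + m` with `1 ≤ X_i` for `i ≥ 1`, `0 ≤ X_i ≤ X_end`, junction ordinates `0`, later
ordinates those of `υ`. [cite: HammersleyTorrieWhittington1982, §2 (concatenation of surface bridges); MadrasSlade1993, §1.2, (1.2.15)] -/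
theorem tailPiece_spec_isWB {m : ℕ} {υ : ℕ → Site 2} (hυ : υ ∈ saws m) (hwb : IsWB m υ) :
    tailPiece υ ∈ saws (2 + m) ∧ (∀ i, 1 ≤ i → i ≤ 2 + m → 1 ≤ tailPiece υ i 0) ∧
      (∀ i ≤ 2 + m, 0 ≤ tailPiece υ i 0 ∧ tailPiece υ i 0 ≤ tailPiece υ (2 + m) 0) ∧
      (∀ i ≤ 2 + m, tailPiece υ i 1 = 0 ∨ ∃ j ≤ m, i = 2 + j ∧ tailPiece υ i 1 = υ j 1) := by
  obtain ⟨h0, -, hbw, hinj⟩ := mem_saws_iff.1 hυ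
  have hX0 : υ 0 0 = 0 := by rw [h0]; rfl
  have hXnn : ∀ j ≤ m, 0 ≤ υ j 0 ∧ υ j 0 ≤ υ m 0 := fun j hj => by
    have := hwb j hj; rw [hX0] at this; exact this
  have hv : ∀ i ≤ 2 + m, (i ≤ 2 ∧ tailPiece υ i 0 = i ∧ tailPiece υ i 1 = 0) ∨
      (∃ j ≤ m, i = 2 + j ∧ tailPiece υ i 0 = 2 + υ j 0 ∧ tailPiece υ i 1 = υ j 1) := by
    intro i hi
    rcases le_or_gt i 2 with h2 | h2
    · exact Or.inl ⟨h2, tailPiece_apply_zero_of_le υ h2, tailPiece_apply_one_of_le υ h2⟩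
    · refine Or.inr ⟨i - 2, by omega, by omega, ?_, ?_⟩
      · rw [show i = 2 + (i - 2) by omega, tailPiece_apply_add_zero h0]; simp
      · rw [show i = 2 + (i - 2) by omega, tailPiece_apply_add_one h0]; simp
  refine ⟨?_, ?_, ?_, ?_⟩
  · have hsep : ∀ i ≤ 2, ∀ j, 1 ≤ j → j ≤ m → Zd.straightWalk 2 2 i ≠ Zd.straightWalk 2 2 2 + υ j := by
      intro i hi j hj1 hj e
      have e0 := congrFun e 0
      rw [Pi.add_apply, straightWalk_apply_zero, straightWalk_apply_zero, min_eq_left hi, min_self] at e0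
      have hj0 := (hXnn j hj).1
      have hi2 : i = 2 := by push_cast at e0; omega
      subst hi2
      have hυj : υ j = 0 := by
        have : Zd.straightWalk 2 2 2 + υ j = Zd.straightWalk 2 2 2 + 0 := by rw [add_zero]; exact e.symm
        exact add_left_cancel this
      have := hinj (show j ∈ {i | i ≤ m} from hj) (show 0 ∈ {i | i ≤ m} from Nat.zero_le _) (by rw [hυj, h0])
      omega
    have hzd : tailPiece υ ∈ Zd.saws 2 (2 + m) := straight_concat_mem_zd 2 (saws_subset _ hυ) hsep
    refine mem_saws.2 ⟨hzd, isBW_concatWalk (isBW_straight 2) hbw h0 ?_⟩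
    rw [straightWalk_apply_zero, straightWalk_apply_one]; simp
  · intro i hi1 hi
    rcases hv i hi with ⟨-, h0', -⟩ | ⟨j, hj, -, h0', -⟩
    · rw [h0']; exact_mod_cast hi1
    · rw [h0']; linarith [(hXnn j hj).1]
  · have hlast : tailPiece υ (2 + m) 0 = 2 + υ m 0 := tailPiece_apply_add_zero h0 m
    intro i hi
    rcases hv i hi with ⟨h2, h0', -⟩ | ⟨j, hj, -, h0', -⟩
    · rw [h0', hlast]
      constructor
      · exact_mod_cast Nat.zero_le i
      · have : (i : ℤ) ≤ 2 := by exact_mod_cast h2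
        linarith [(hXnn m le_rfl).1]
    · rw [h0', hlast]
      constructor
      · linarith [(hXnn j hj).1]
      · linarith [(hXnn j hj).2]
  · intro i hi
    rcases hv i hi with ⟨-, -, h1⟩ | ⟨j, hj, hij, -, h1⟩
    · exact Or.inl h1
    · exact Or.inr ⟨j, hj, hij, h1⟩

/-- `revN` of an x-bridge is an x-bridge (`X_i ↦ X_n − X_{n−i}`). [cite: MadrasSlade1993, §3.1 (proof of Theorem 3.1.1)] -/
theorem isWB_revN (hwb : IsWB n ω) : IsWB n (revN n ω) := by
  intro i hi
  rw [revN_apply_zero, revN_apply_zero, revN_apply_zero, Nat.sub_zero, Nat.sub_self]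
  have h1 := hwb (n - i) (Nat.sub_le _ _)
  have h2 := hwb n le_rfl
  have h3 := hwb 0 (Nat.zero_le _)
  constructor <;> linarith [h1.1, h1.2, h2.1, h3.2]

/-! ### The mirror join -/

/-- **The mirror join** of two free-start x-bridges: `ω`, the junction `E → E+e₀ → E+2e₀`, then the translate of
`revN n ω'`. [cite: HammersleyTorrieWhittington1982, §2; JansevanRensburg2000, §5.4 (1st ed. pp. 167–168: pairs of walks with the most popular end height)] -/
def mloop (n : ℕ) (ω ω' : ℕ → Site 2) : ℕ → Site 2 := jcat n ω (revN n ω')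

/-- **The mirror join of two members of `fbrE s h n e` (`n` even) is a member of `fbrE s h (n+(2+n)) 0`**: a
free-start x-bridge of length `2n+2` in the same region, returning to ordinate `0`.
[cite: HammersleyTorrieWhittington1982, §2; MadrasSlade1993, §1.2, (1.2.15); JansevanRensburg2000, §5.4 (1st ed. pp. 167–170)] -/
theorem mloop_mem {s h e : ℤ} {ω ω' : ℕ → Site 2} (hn : n % 2 = 0) (hω : ω ∈ fbrE s h n e)
    (hω' : ω' ∈ fbrE s h n e) : mloop n ω ω' ∈ fbrE s h (n + (2 + n)) 0 := by
  obtain ⟨hωb, hend⟩ := mem_fbrE.1 hω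
  obtain ⟨hωf, hwb⟩ := mem_fbr.1 hωb
  obtain ⟨hωs, hreg⟩ := mem_fcls.1 hωf
  obtain ⟨hω'b, hend'⟩ := mem_fbrE.1 hω'
  obtain ⟨hω'f, hwb'⟩ := mem_fbr.1 hω'b
  obtain ⟨hω's, hreg'⟩ := mem_fcls.1 hω'f
  obtain ⟨h0, -, hbw, -⟩ := mem_saws_iff.1 hωs
  obtain ⟨h0', -, -, -⟩ := mem_saws_iff.1 hω's
  set υ := revN n ω' with hυdef
  have hυs : υ ∈ saws n := revN_mem hω's hn
  have hυwb : IsWB n υ := isWB_revN hwb'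
  obtain ⟨hT, hTX1, hTX, hTY⟩ := tailPiece_spec_isWB hυs hυwb
  obtain ⟨hT0, -, hTbw, -⟩ := mem_saws_iff.1 hT
  have hυ0 : υ 0 = 0 := (mem_saws_iff.1 hυs).1
  have hpar : (ω n 0 + ω n 1) % 2 = 0 := by have := parity_apply hωs le_rfl; omega
  have hv1 : ∀ i ≤ n, mloop n ω ω' i = ω i := fun i hi => Zd.concatWalk_apply_of_le _ _ hi
  have hv2 : ∀ j, mloop n ω ω' (n + j) = ω n + tailPiece υ j := fun j => Zd.concatWalk_apply_add _ _ hT0 j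
  have hmem : mloop n ω ω' ∈ saws (n + (2 + n)) := by
    refine mem_saws.2 ⟨Zd.concatWalk_mem_saws (saws_subset _ hωs) (saws_subset _ hT) ?_,
      isBW_concatWalk hbw hTbw hT0 hpar⟩
    intro i hi j hj1 hj e
    have e0 := congrFun e 0
    rw [Pi.add_apply] at e0
    rw [← hυdef] at e0
    have := (hwb i hi).2
    have := hTX1 j hj1 hj
    omega
  have hωY' : ∀ j, υ j 1 = ω' (n - j) 1 - e := fun j => by rw [hυdef, revN_apply_one, hend']
  refine mem_fbrE.2 ⟨mem_fbr.2 ⟨mem_fcls.2 ⟨hmem, fun i hi => ?_⟩, fun i hi => ?_⟩, ?_⟩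
  · -- region
    rcases le_or_gt i n with h | h
    · rw [hv1 i h]; exact hreg i h
    · rw [show i = n + (i - n) by omega, hv2, Pi.add_apply, hend]
      rcases hTY (i - n) (by omega) with h1 | ⟨j, hj, -, h1⟩
      · rw [h1, add_zero, ← hend]; exact hreg n le_rfl
      · rw [h1, hωY' j, add_sub_cancel]; exact hreg' (n - j) (Nat.sub_le _ _)
  · -- x-bridge
    have hlast : mloop n ω ω' (n + (2 + n)) 0 = ω n 0 + tailPiece υ (2 + n) 0 := by rw [hv2, Pi.add_apply]
    have hfirst : mloop n ω ω' 0 0 = ω 0 0 := by rw [hv1 0 (Nat.zero_le _)]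
    rw [hlast, hfirst]
    rcases le_or_gt i n with h | h
    · rw [hv1 i h]
      have := hwb i h
      have := (hTX (2 + n) le_rfl).1
      constructor <;> linarith
    · rw [show i = n + (i - n) by omega, hv2, Pi.add_apply]
      have := hTX (i - n) (by omega)
      have := hwb n le_rfl
      constructor <;> linarith
  · -- returns to ordinate 0
    rw [hv2, Pi.add_apply, hend, tailPiece_apply_add_one hυ0 n, hωY' n, Nat.sub_self,
      show ω' 0 1 = 0 by rw [h0']; rfl]
    ring

/-- **Visits of the mirror join**: `v(ω) + v(ω') ≤ v(mloop n ω ω') ≤ v(ω) + v(ω') + 1` for every parity class `q`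
(`n` even; the junction and the displaced endpoint account for at most one extra visit).
[cite: HammersleyTorrieWhittington1982, §2 (visits of concatenated surface bridges); MadrasSlade1993, §3.1] -/
theorem visitsAt_mloop (q : ℕ) {s h e : ℤ} {ω ω' : ℕ → Site 2} (hn : n % 2 = 0) (hω : ω ∈ fbrE s h n e)
    (hω' : ω' ∈ fbrE s h n e) :
    visitsAt q s h n ω + visitsAt q s h n ω' ≤ visitsAt q s h (n + (2 + n)) (mloop n ω ω') ∧
      visitsAt q s h (n + (2 + n)) (mloop n ω ω') ≤ visitsAt q s h n ω + visitsAt q s h n ω' + 1 := by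
  obtain ⟨hωb, hend⟩ := mem_fbrE.1 hω
  obtain ⟨hω'b, hend'⟩ := mem_fbrE.1 hω'
  obtain ⟨hω'f, hwb'⟩ := mem_fbr.1 hω'b
  obtain ⟨hω's, -⟩ := mem_fcls.1 hω'f
  obtain ⟨h0', -, -, -⟩ := mem_saws_iff.1 hω's
  set υ := revN n ω' with hυdef
  have hυs : υ ∈ saws n := revN_mem hω's hn
  have hυ0 : υ 0 = 0 := (mem_saws_iff.1 hυs).1
  have hT0 : tailPiece υ 0 = 0 := (mem_saws_iff.1 (tailPiece_spec_isWB hυs (isWB_revN hwb')).1).1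
  have hv1 : ∀ i ≤ n, mloop n ω ω' i = ω i := fun i hi => Zd.concatWalk_apply_of_le _ _ hi
  have hv2 : ∀ j, mloop n ω ω' (n + j) = ω n + tailPiece υ j := fun j => Zd.concatWalk_apply_add _ _ hT0 j
  -- split at the cut `n` (level shift `h ↦ h - s e`) and at the end of the junction
  have hsplit : visitsAt q s h (n + (2 + n)) (mloop n ω ω') =
      visitsAt q s h n ω + (visitsAt q s (h - s * e) 2 (tailPiece υ) + visitsAt q s (h - s * e) n υ) := by
    rw [visitsAt_add (a := n) (b := 2 + n) (c' := h - s * e) (ξ := tailPiece υ) hn fun j _ _ => by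
      rw [hv2, Pi.add_apply, hend, mul_add]; constructor <;> intro hh <;> linarith]
    rw [visitsAt_congr (c' := h) (ξ := ω) fun i _ hi => by rw [hv1 i hi],
      visitsAt_add (a := 2) (b := n) (c' := h - s * e) (ξ := υ) (by decide) fun j _ _ => by
        rw [tailPiece_apply_add_one hυ0 j]]
  -- the junction contributes `[q=1 ∧ se=h] + [q=0 ∧ se=h]` (junction ordinates are `0`)
  have hJ1 : tailPiece υ 1 1 = 0 := tailPiece_apply_one_of_le υ (by norm_num)
  have hJ2 : tailPiece υ 2 1 = 0 := tailPiece_apply_one_of_le υ le_rfl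
  -- the reversed piece: `visitsAt_revN` at level `h` (note `h - s e = h - s Y'_n`)
  have hR := visitsAt_revN q s h hn ω'
  rw [hend', show ω' 0 1 = 0 by rw [h0']; rfl, ← hυdef] at hR
  rw [hsplit, visitsAt_two, hJ1, hJ2]
  simp only [mul_zero] at hR ⊢
  constructor <;> split_ifs at * <;> omega

/-- `min(y,1) · y^b ≤ y^a` whenever `b ≤ a ≤ b+1` (`y ≥ 0`). [cite: MadrasSlade1993, §1.2] -/
theorem min_mul_pow_le (hy : 0 ≤ y) {a b : ℕ} (h1 : b ≤ a) (h2 : a ≤ b + 1) : min y 1 * y ^ b ≤ y ^ a := by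
  rcases Nat.eq_or_lt_of_le h1 with rfl | hlt
  · calc min y 1 * y ^ b ≤ 1 * y ^ b := mul_le_mul_of_nonneg_right (min_le_right _ _) (pow_nonneg hy _)
      _ = y ^ b := one_mul _
  · have : a = b + 1 := by omega
    subst this
    rw [pow_succ, mul_comm]
    exact mul_le_mul_of_nonneg_left (min_le_left _ _) (pow_nonneg hy _)

/-- **`min(y,1) · HBE q s h n e y ² ≤ HBE q s h (n+(2+n)) 0 y`** (`n` even, `y ≥ 0`): the mirror join is injective
on `fbrE s h n e × fbrE s h n e` and loses at most one factor `y`.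
[cite: HammersleyTorrieWhittington1982, §2 (supermultiplicativity of surface bridges); MadrasSlade1993, §1.2, (1.2.15); JansevanRensburg2000, §5.4 (1st ed. pp. 167–170)] -/
theorem mul_HBE_sq_le (q : ℕ) (s h e : ℤ) (hn : n % 2 = 0) (hy : 0 ≤ y) :
    min y 1 * HBE q s h n e y ^ 2 ≤ HBE q s h (n + (2 + n)) 0 y := by
  classical
  set N := n + (2 + n) with hN
  have hsub : fbrE s h n e ⊆ saws n := fun ω hω =>
    fcls_subset s h n (fbr_subset s h n (mem_fbrE.1 hω).1)
  have hinj : Set.InjOn (fun p : (ℕ → Site 2) × (ℕ → Site 2) => mloop n p.1 p.2) ↑(fbrE s h n e ×ˢ fbrE s h n e) := by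
    rintro ⟨ω, υ⟩ hp ⟨ω', υ'⟩ hp' hh
    rw [Finset.mem_coe, Finset.mem_product] at hp hp'
    dsimp only at hh hp hp'
    have hωs := hsub hp.1
    have hω's := hsub hp'.1
    have hυs := hsub hp.2
    have hυ's := hsub hp'.2
    have hr := revN_mem hυs hn
    have hr' := revN_mem hυ's hn
    have hT := (tailPiece_spec_isWB hr (isWB_revN (mem_fbr.1 (mem_fbrE.1 hp.2).1).2)).1
    have hT' := (tailPiece_spec_isWB hr' (isWB_revN (mem_fbr.1 (mem_fbrE.1 hp'.2).1).2)).1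
    obtain ⟨h1, h2⟩ := Zd.concatWalk_injective_pieces (saws_subset _ hωs) (saws_subset _ hT)
      (saws_subset _ hω's) (saws_subset _ hT') hh
    have h3 := tailPiece_injective (mem_saws_iff.1 hr).1 (mem_saws_iff.1 hr').1 h2
    obtain ⟨hu0, huend, -, -⟩ := mem_saws_iff.1 hυs
    obtain ⟨hu0', huend', -, -⟩ := mem_saws_iff.1 hυ's
    have h4 : υ = υ' := by
      rw [← revN_revN hu0 huend, ← revN_revN hu0' huend', h3]
    simp only [Prod.mk.injEq]
    exact ⟨h1, h4⟩
  calc min y 1 * HBE q s h n e y ^ 2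
      = ∑ ω ∈ fbrE s h n e, ∑ ω' ∈ fbrE s h n e,
          min y 1 * y ^ (visitsAt q s h n ω + visitsAt q s h n ω') := by
        rw [sq, HBE, Finset.sum_mul_sum, Finset.mul_sum]
        refine Finset.sum_congr rfl fun ω _ => ?_
        rw [Finset.mul_sum]
        refine Finset.sum_congr rfl fun ω' _ => ?_
        rw [pow_add]
    _ ≤ ∑ ω ∈ fbrE s h n e, ∑ ω' ∈ fbrE s h n e, y ^ visitsAt q s h N (mloop n ω ω') := by
        refine Finset.sum_le_sum fun ω hω => Finset.sum_le_sum fun ω' hω' => ?_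
        obtain ⟨h1, h2⟩ := visitsAt_mloop q hn hω hω'
        exact min_mul_pow_le hy h1 h2
    _ = ∑ p ∈ fbrE s h n e ×ˢ fbrE s h n e, y ^ visitsAt q s h N (mloop n p.1 p.2) := by
        rw [Finset.sum_product]
    _ = ∑ ζ ∈ (fbrE s h n e ×ˢ fbrE s h n e).image (fun p => mloop n p.1 p.2), y ^ visitsAt q s h N ζ :=
        (Finset.sum_image (f := fun ζ => y ^ visitsAt q s h N ζ) hinj).symm
    _ ≤ HBE q s h N 0 y := by
        refine Finset.sum_le_sum_of_subset_of_nonneg (fun ζ hζ => ?_) fun _ _ _ => pow_nonneg hy _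
        obtain ⟨p, hp, rfl⟩ := Finset.mem_image.1 hζ
        rw [Finset.mem_product] at hp
        exact mloop_mem hn hp.1 hp.2

/-- **One canonical class of free-start surface loops carries the surface growth rate**: for every `y > 0` and
`j` there is `0 ≤ h ≤ 2j+1` with
`min(y,1) · μ(y)^{2j} · μ(y)^{2j} ≤ (e^{6√(2j)} · (2·2j+1))² · HBE 0 1 h (2j + (2 + 2j)) 0 y` (surface above,
even-time visits — the class of Parts I–II).
[cite: JansevanRensburg2000, §5.4 (1st ed. pp. 167–170); HammersleyTorrieWhittington1982, §2; BeatonBousquetMelouDeGierDuminilCopinGuttmann2014, §3.1, Proposition 5 (arXiv v5 p. 9)] -/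
theorem exists_pow_le_HBE_zero (hy : 0 < y) (j : ℕ) :
    ∃ h : ℤ, 0 ≤ h ∧ h ≤ 2 * j + 1 ∧
      min y 1 * (HV.surfaceMu y ^ (2 * j) * HV.surfaceMu y ^ (2 * j)) ≤
        (Real.exp (6 * Real.sqrt (2 * j : ℕ)) * (2 * (2 * j : ℕ) + 1)) ^ 2 * HBE 0 1 h (2 * j + (2 + 2 * j)) 0 y := by
  obtain ⟨h, h0, h1, e, -, hle⟩ := exists_pow_le_HBE hy j
  refine ⟨h, h0, h1, ?_⟩
  set E := Real.exp (6 * Real.sqrt (2 * j : ℕ)) * (2 * (2 * j : ℕ) + 1) with hE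
  set X := HBE 0 1 h (2 * j) e y with hX
  have hμ : 0 ≤ HV.surfaceMu y ^ (2 * j) := pow_nonneg (HV.surfaceMu_pos y).le _
  have hle' : HV.surfaceMu y ^ (2 * j) ≤ E * X := by rw [hE, mul_assoc]; exact hle
  have hsq : HV.surfaceMu y ^ (2 * j) * HV.surfaceMu y ^ (2 * j) ≤ (E * X) * (E * X) :=
    mul_le_mul hle' hle' hμ (hμ.trans hle')
  have hmin : 0 ≤ min y 1 := le_min hy.le zero_le_one
  calc min y 1 * (HV.surfaceMu y ^ (2 * j) * HV.surfaceMu y ^ (2 * j))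
      ≤ min y 1 * ((E * X) * (E * X)) := mul_le_mul_of_nonneg_left hsq hmin
    _ = E ^ 2 * (min y 1 * X ^ 2) := by ring
    _ ≤ E ^ 2 * HBE 0 1 h (2 * j + (2 + 2 * j)) 0 y :=
        mul_le_mul_of_nonneg_left (mul_HBE_sq_le 0 1 h e (by omega) hy.le) (sq_nonneg _)

/-! ## Part C — The strip-locality rate at every fugacity
(code of HOME car 18 `HexSAWStripSurfaceRateAllY_ed3_9fed32165ff5ce82.lean`, sha16 `9fed32165ff5ce82`)

Parts A–B2 produced, for every `y > 0` and every `j`, ONE canonical class of free-start surface LOOPS — brick-wall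
SAWs of length `N = 4j+2` from ordinate `0` back to ordinate `0`, `X_0 ≤ X_i ≤ X_N`, all ordinates `≤ h` for some
`0 ≤ h ≤ 2j+1`, weighted by `y^{#even-time visits to the line Y = h}` — whose weight is at least
`min(y,1) μ(y)^{4j} / (e^{6√(2j)} (4j+1))²`.  Here:

* `lpsD s h n D`, `HLD` — the loops of depth `≤ D` (`-D ≤ s·Y`) and their weight; `fbrE_zero_subset_lpsD` (crude depth
  `|Y_i| ≤ i ≤ n`), `HBE_zero_le_HLD`;
* `jcat_mem_lpsD`, `visitsAt_jcat`, **`mul_HLD_le`** — junction concatenation of two loops is a loop of the same region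
  and depth, visits add up to one unit: `min y 1 · HLD(n₁) · HLD(n₂) ≤ HLD(n₁+2+n₂)` (`n₁` even);
  **`pow_mul_HLD_pow_le`** — powers;
* `lstart h := ((h+1) mod 2, h)`, `emb_mem_stripPairs`, `bottomVisits₀_emb`, **`mul_HLD_le_stripZ₀`** — the glide
  reflection `(X, Y) ↦ (X + c, h - Y)`, `c + h` odd, carries a loop of the canonical class with `h + D ≤ T` to a walk of
  the strip `S_T` started in the cross-section, and its even-time visits to the line `Y = h` to the PRINTED level-`0`
  vertices of the bottom row (odd abscissa): `min y 1 · HLD 0 1 h N D y ≤ C_{T,N}(y,1)`;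
* **`rpow_HLD_le_stripMuY₀`** — `(min y 1 · HLD 0 1 h N D y)^{1/(N+2)} ≤ μ_T(y,1)` for `h + D ≤ T`;
* **`log_surfaceMu_sub_log_stripMuY₀_le`** — for every `y > 0`, `j` and `T ≥ 6j+3`,
  `log μ(y) - log μ_T(y,1) ≤ (4 log μ(y) - 2 log min(y,1) + 2(6√(2j) + log(4j+1))) / (4j+4)`; with S7's lossless
  sign `μ_T(y,1) ≤ μ(y)` the two-sided **`abs_log_surfaceMu_sub_log_stripMuY₀_le`**;
* **`log_surfaceMu_le_of_strip`**, **`surfaceMu_le_stripMuY₀_rpow_mul_exp`** (`j ≥ 1`, `T ≥ 6j+3`), `log_surfaceMu_le_of_strip'`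
  (`T ≥ 9`, `j = ⌊(T-3)/6⌋`) — the rate SOLVED for `μ(y)`:
  `μ(y) ≤ μ_T(y,1)^{(j+1)/j} · exp((-2 log min(y,1) + 2(6√(2j) + log(4j+1)))/(4j))`.
-/

/-! ### Loops of bounded depth -/

open Classical in
/-- **Free-start surface loops of depth `≤ D`**: the members of `fbrE s h n 0` (free-start x-bridges of the region
`s·Y ≤ h` returning to ordinate `0`) with `-D ≤ s·Y_i` for all `i ≤ n`.
[cite: HammersleyTorrieWhittington1982, §2 (surface loops and bridges); JansevanRensburg2000, §5.4 (1st ed. pp. 167–170)] -/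
def lpsD (s h : ℤ) (n D : ℕ) : Finset (ℕ → Site 2) :=
  (fbrE s h n 0).filter (fun ω => ∀ i ≤ n, -(D : ℤ) ≤ s * ω i 1)

/-- Membership in `lpsD`. [cite: HammersleyTorrieWhittington1982, §2] -/
theorem mem_lpsD {s h : ℤ} {D : ℕ} : ω ∈ lpsD s h n D ↔ ω ∈ fbrE s h n 0 ∧ ∀ i ≤ n, -(D : ℤ) ≤ s * ω i 1 := by
  classical
  exact Finset.mem_filter

/-- A member of `lpsD` is a brick-wall SAW. [cite: MadrasSlade1993, §1.1] -/
theorem saws_of_mem_lpsD {s h : ℤ} {D : ℕ} (hω : ω ∈ lpsD s h n D) : ω ∈ saws n :=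
  fcls_subset s h n (fbr_subset s h n (mem_fbrE.1 (mem_lpsD.1 hω).1).1)

/-- **Weight of the loops of depth `≤ D`** in the class `(q, s)` at level `h`.
[cite: HammersleyTorrieWhittington1982, §2 (generating functions of surface loops); JansevanRensburg2000, §5.4 (1st ed. pp. 167–170)] -/
def HLD (q : ℕ) (s h : ℤ) (n D : ℕ) (y : ℝ) : ℝ := ∑ ω ∈ lpsD s h n D, y ^ visitsAt q s h n ω

/-- `0 ≤ HLD` (`y ≥ 0`). [cite: HammersleyTorrieWhittington1982, §2] -/
theorem HLD_nonneg (q : ℕ) (s h : ℤ) (n D : ℕ) (hy : 0 ≤ y) : 0 ≤ HLD q s h n D y :=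
  Finset.sum_nonneg fun _ _ => pow_nonneg hy _

/-- Crude depth: every loop of length `n` has depth `≤ n` (`|Y_i| ≤ i`). [cite: MadrasSlade1993, §1.1] -/
theorem fbrE_zero_subset_lpsD {s h : ℤ} (hs : s = 1 ∨ s = -1) (n : ℕ) : fbrE s h n 0 ⊆ lpsD s h n n := by
  intro ω hω
  refine mem_lpsD.2 ⟨hω, fun i hi => ?_⟩
  have hωs : ω ∈ saws n := fcls_subset s h n (fbr_subset s h n (mem_fbrE.1 hω).1)
  obtain ⟨h0, -, hadj, -⟩ := Zd.mem_saws.1 (saws_subset n hωs)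
  have := abs_le.1 (Zd.abs_apply_le_of_adj h0 hadj i hi 1)
  rcases hs with rfl | rfl <;> omega

/-- `HBE q s h n 0 y ≤ HLD q s h n n y` (`y ≥ 0`). [cite: HammersleyTorrieWhittington1982, §2] -/
theorem HBE_zero_le_HLD (q : ℕ) {s : ℤ} (hs : s = 1 ∨ s = -1) (h : ℤ) (n : ℕ) (hy : 0 ≤ y) :
    HBE q s h n 0 y ≤ HLD q s h n n y :=
  Finset.sum_le_sum_of_subset_of_nonneg (fbrE_zero_subset_lpsD hs n) fun _ _ _ => pow_nonneg hy _

/-! ### Chaining loops: junction concatenation at fixed depth -/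

/-- **The junction concatenation of two loops is a loop** of the same region and depth: for `n₁` even,
`ω ∈ lpsD s h n₁ D`, `ω' ∈ lpsD s h n₂ D` ⟹ `jcat n₁ ω ω' ∈ lpsD s h (n₁+(2+n₂)) D` (both pieces are based at
ordinate `0`, the junction runs along `Y = 0`, self-avoidance by abscissae).
[cite: HammersleyTorrieWhittington1982, §2 (2.5)–(2.6) (concatenation of surface bridges); MadrasSlade1993, §1.2, (1.2.15)] -/
theorem jcat_mem_lpsD {s h : ℤ} {n₁ n₂ D : ℕ} {ω ω' : ℕ → Site 2} (hn₁ : n₁ % 2 = 0)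
    (hω : ω ∈ lpsD s h n₁ D) (hω' : ω' ∈ lpsD s h n₂ D) : jcat n₁ ω ω' ∈ lpsD s h (n₁ + (2 + n₂)) D := by
  obtain ⟨hωE, hdep⟩ := mem_lpsD.1 hω
  obtain ⟨hωb, hend⟩ := mem_fbrE.1 hωE
  obtain ⟨hωf, hwb⟩ := mem_fbr.1 hωb
  obtain ⟨hωs, hreg⟩ := mem_fcls.1 hωf
  obtain ⟨hω'E, hdep'⟩ := mem_lpsD.1 hω'
  obtain ⟨hω'b, hend'⟩ := mem_fbrE.1 hω'E
  obtain ⟨hω'f, hwb'⟩ := mem_fbr.1 hω'b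
  obtain ⟨hω's, hreg'⟩ := mem_fcls.1 hω'f
  obtain ⟨h0, -, hbw, -⟩ := mem_saws_iff.1 hωs
  obtain ⟨h0', -, -, -⟩ := mem_saws_iff.1 hω's
  obtain ⟨hT, hTX1, hTX, hTY⟩ := tailPiece_spec_isWB hω's hwb'
  obtain ⟨hT0, -, hTbw, -⟩ := mem_saws_iff.1 hT
  have hpar : (ω n₁ 0 + ω n₁ 1) % 2 = 0 := by have := parity_apply hωs le_rfl; omega
  have hv1 : ∀ i ≤ n₁, jcat n₁ ω ω' i = ω i := fun i hi => Zd.concatWalk_apply_of_le _ _ hi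
  have hv2 : ∀ j, jcat n₁ ω ω' (n₁ + j) = ω n₁ + tailPiece ω' j := fun j =>
    Zd.concatWalk_apply_add _ _ hT0 j
  have h0h : 0 ≤ h := by have := hreg 0 (Nat.zero_le _); rw [h0] at this; simpa using this
  have hmem : jcat n₁ ω ω' ∈ saws (n₁ + (2 + n₂)) := by
    refine mem_saws.2 ⟨Zd.concatWalk_mem_saws (saws_subset _ hωs) (saws_subset _ hT) ?_,
      isBW_concatWalk hbw hTbw hT0 hpar⟩
    intro i hi j hj1 hj e
    have e0 := congrFun e 0
    rw [Pi.add_apply] at e0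
    have := (hwb i hi).2
    have := hTX1 j hj1 hj
    omega
  -- ordinates after the cut: `0` on the junction, those of `ω'` after it
  have hY2 : ∀ j ≤ 2 + n₂, (ω n₁ + tailPiece ω' j) 1 = 0 ∨ ∃ j' ≤ n₂, (ω n₁ + tailPiece ω' j) 1 = ω' j' 1 := by
    intro j hj
    rw [Pi.add_apply, hend, zero_add]
    rcases hTY j hj with h1 | ⟨j', hj', -, h1⟩
    · exact Or.inl h1
    · exact Or.inr ⟨j', hj', h1⟩
  refine mem_lpsD.2 ⟨mem_fbrE.2 ⟨mem_fbr.2 ⟨mem_fcls.2 ⟨hmem, fun i hi => ?_⟩, fun i hi => ?_⟩, ?_⟩,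
    fun i hi => ?_⟩
  · -- region
    rcases le_or_gt i n₁ with hle | hlt
    · rw [hv1 i hle]; exact hreg i hle
    · rw [show i = n₁ + (i - n₁) by omega, hv2]
      rcases hY2 (i - n₁) (by omega) with h1 | ⟨j', hj', h1⟩
      · rw [h1, mul_zero]; exact h0h
      · rw [h1]; exact hreg' j' hj'
  · -- x-bridge
    have hlast : jcat n₁ ω ω' (n₁ + (2 + n₂)) 0 = ω n₁ 0 + tailPiece ω' (2 + n₂) 0 := by rw [hv2, Pi.add_apply]
    have hfirst : jcat n₁ ω ω' 0 0 = ω 0 0 := by rw [hv1 0 (Nat.zero_le _)]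
    rw [hlast, hfirst]
    rcases le_or_gt i n₁ with hle | hlt
    · rw [hv1 i hle]
      have := hwb i hle
      have := (hTX (2 + n₂) le_rfl).1
      constructor <;> linarith
    · rw [show i = n₁ + (i - n₁) by omega, hv2, Pi.add_apply]
      have := hTX (i - n₁) (by omega)
      have := hwb n₁ le_rfl
      constructor <;> linarith
  · -- returns to ordinate 0
    rw [hv2, Pi.add_apply, hend, tailPiece_apply_add_one h0' n₂, hend', add_zero]
  · -- depth
    rcases le_or_gt i n₁ with hle | hlt
    · rw [hv1 i hle]; exact hdep i hle
    · rw [show i = n₁ + (i - n₁) by omega, hv2]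
      rcases hY2 (i - n₁) (by omega) with h1 | ⟨j', hj', h1⟩
      · rw [h1, mul_zero]; omega
      · rw [h1]; exact hdep' j' hj'

/-- **Visits of the chain**: `v(ω) + v(ω') ≤ v(jcat n₁ ω ω') ≤ v(ω) + v(ω') + 1` (`n₁` even; the junction lies on
`Y = 0` and is visited at most once at a time of parity `q`). [cite: HammersleyTorrieWhittington1982, §2 (2.5)–(2.6)] -/
theorem visitsAt_jcat (q : ℕ) {s h : ℤ} {n₁ n₂ D : ℕ} {ω ω' : ℕ → Site 2} (hn₁ : n₁ % 2 = 0)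
    (hω : ω ∈ lpsD s h n₁ D) (hω' : ω' ∈ lpsD s h n₂ D) :
    visitsAt q s h n₁ ω + visitsAt q s h n₂ ω' ≤ visitsAt q s h (n₁ + (2 + n₂)) (jcat n₁ ω ω') ∧
      visitsAt q s h (n₁ + (2 + n₂)) (jcat n₁ ω ω') ≤ visitsAt q s h n₁ ω + visitsAt q s h n₂ ω' + 1 := by
  obtain ⟨hωE, -⟩ := mem_lpsD.1 hω
  obtain ⟨-, hend⟩ := mem_fbrE.1 hωE
  obtain ⟨hω'E, -⟩ := mem_lpsD.1 hω'
  obtain ⟨hω'b, -⟩ := mem_fbrE.1 hω'E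
  obtain ⟨hω'f, hwb'⟩ := mem_fbr.1 hω'b
  obtain ⟨hω's, -⟩ := mem_fcls.1 hω'f
  obtain ⟨h0', -, -, -⟩ := mem_saws_iff.1 hω's
  have hT0 : tailPiece ω' 0 = 0 := (mem_saws_iff.1 (tailPiece_spec_isWB hω's hwb').1).1
  have hv1 : ∀ i ≤ n₁, jcat n₁ ω ω' i = ω i := fun i hi => Zd.concatWalk_apply_of_le _ _ hi
  have hv2 : ∀ j, jcat n₁ ω ω' (n₁ + j) = ω n₁ + tailPiece ω' j := fun j =>
    Zd.concatWalk_apply_add _ _ hT0 j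
  have hsplit : visitsAt q s h (n₁ + (2 + n₂)) (jcat n₁ ω ω') =
      visitsAt q s h n₁ ω + (visitsAt q s h 2 (tailPiece ω') + visitsAt q s h n₂ ω') := by
    rw [visitsAt_add (a := n₁) (b := 2 + n₂) (c' := h) (ξ := tailPiece ω') hn₁ fun j _ _ => by
      rw [hv2, Pi.add_apply, hend, zero_add]]
    rw [visitsAt_congr (c' := h) (ξ := ω) fun i _ hi => by rw [hv1 i hi],
      visitsAt_add (a := 2) (b := n₂) (c' := h) (ξ := ω') (by decide) fun j _ _ => by
        rw [tailPiece_apply_add_one h0' j]]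
  have hJ1 : tailPiece ω' 1 1 = 0 := tailPiece_apply_one_of_le ω' (by norm_num)
  have hJ2 : tailPiece ω' 2 1 = 0 := tailPiece_apply_one_of_le ω' le_rfl
  rw [hsplit, visitsAt_two, hJ1, hJ2]
  simp only [mul_zero]
  constructor <;> split_ifs <;> omega

/-- **Supermultiplicativity of the loops at fixed depth**: `min(y,1) · HLD(n₁) · HLD(n₂) ≤ HLD(n₁+2+n₂)` (`n₁` even,
`y ≥ 0`; the chain is injective by `Zd.concatWalk_injective_pieces` and `tailPiece_injective`).
[cite: HammersleyTorrieWhittington1982, §2 (2.5)–(2.6) (supermultiplicativity of surface bridges); MadrasSlade1993, §1.2, (1.2.15)] -/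
theorem mul_HLD_le (q : ℕ) (s h : ℤ) {n₁ : ℕ} (hn₁ : n₁ % 2 = 0) (n₂ D : ℕ) (hy : 0 ≤ y) :
    min y 1 * (HLD q s h n₁ D y * HLD q s h n₂ D y) ≤ HLD q s h (n₁ + (2 + n₂)) D y := by
  classical
  set N := n₁ + (2 + n₂) with hN
  have hinj : Set.InjOn (fun p : (ℕ → Site 2) × (ℕ → Site 2) => jcat n₁ p.1 p.2)
      ↑(lpsD s h n₁ D ×ˢ lpsD s h n₂ D) := by
    rintro ⟨ω, υ⟩ hp ⟨ω', υ'⟩ hp' hh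
    rw [Finset.mem_coe, Finset.mem_product] at hp hp'
    dsimp only at hh hp hp'
    have hωs := saws_of_mem_lpsD hp.1
    have hω's := saws_of_mem_lpsD hp'.1
    have hυs := saws_of_mem_lpsD hp.2
    have hυ's := saws_of_mem_lpsD hp'.2
    have hT := (tailPiece_spec_isWB hυs (mem_fbr.1 (mem_fbrE.1 (mem_lpsD.1 hp.2).1).1).2).1
    have hT' := (tailPiece_spec_isWB hυ's (mem_fbr.1 (mem_fbrE.1 (mem_lpsD.1 hp'.2).1).1).2).1
    obtain ⟨h1, h2⟩ := Zd.concatWalk_injective_pieces (saws_subset _ hωs) (saws_subset _ hT)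
      (saws_subset _ hω's) (saws_subset _ hT') hh
    have h3 := tailPiece_injective (mem_saws_iff.1 hυs).1 (mem_saws_iff.1 hυ's).1 h2
    simp only [Prod.mk.injEq]
    exact ⟨h1, h3⟩
  calc min y 1 * (HLD q s h n₁ D y * HLD q s h n₂ D y)
      = ∑ ω ∈ lpsD s h n₁ D, ∑ ω' ∈ lpsD s h n₂ D,
          min y 1 * y ^ (visitsAt q s h n₁ ω + visitsAt q s h n₂ ω') := by
        rw [HLD, HLD, Finset.sum_mul_sum, Finset.mul_sum]
        refine Finset.sum_congr rfl fun ω _ => ?_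
        rw [Finset.mul_sum]
        refine Finset.sum_congr rfl fun ω' _ => ?_
        rw [pow_add]
    _ ≤ ∑ ω ∈ lpsD s h n₁ D, ∑ ω' ∈ lpsD s h n₂ D, y ^ visitsAt q s h N (jcat n₁ ω ω') := by
        refine Finset.sum_le_sum fun ω hω => Finset.sum_le_sum fun ω' hω' => ?_
        obtain ⟨h1, h2⟩ := visitsAt_jcat q hn₁ hω hω'
        exact min_mul_pow_le hy h1 h2
    _ = ∑ p ∈ lpsD s h n₁ D ×ˢ lpsD s h n₂ D, y ^ visitsAt q s h N (jcat n₁ p.1 p.2) := by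
        rw [Finset.sum_product]
    _ = ∑ ζ ∈ (lpsD s h n₁ D ×ˢ lpsD s h n₂ D).image (fun p => jcat n₁ p.1 p.2), y ^ visitsAt q s h N ζ :=
        (Finset.sum_image (f := fun ζ => y ^ visitsAt q s h N ζ) hinj).symm
    _ ≤ HLD q s h N D y := by
        refine Finset.sum_le_sum_of_subset_of_nonneg (fun ζ hζ => ?_) fun _ _ _ => pow_nonneg hy _
        obtain ⟨p, hp, rfl⟩ := Finset.mem_image.1 hζ
        rw [Finset.mem_product] at hp
        exact jcat_mem_lpsD hn₁ hp.1 hp.2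

/-- Parity of the chain lengths: `(N+2)k + N` is even for `N` even. [cite: MadrasSlade1993, §1.2] -/
theorem chainLen_mod_two {N : ℕ} (hN : N % 2 = 0) (k : ℕ) : ((N + 2) * k + N) % 2 = 0 := by
  rw [Nat.add_mod, Nat.mul_mod, show (N + 2) % 2 = 0 by omega, zero_mul, Nat.zero_mod, zero_add, hN]

/-- **Powers at fixed depth**: `min(y,1)^k · HLD(N)^{k+1} ≤ HLD((N+2)k + N)` (`N` even, `y ≥ 0`) — chains of `k+1` loops.
[cite: HammersleyTorrieWhittington1982, §2 (2.5)–(2.6)] -/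
theorem pow_mul_HLD_pow_le (q : ℕ) (s h : ℤ) {N : ℕ} (hN : N % 2 = 0) (D : ℕ) (hy : 0 ≤ y) (k : ℕ) :
    min y 1 ^ k * HLD q s h N D y ^ (k + 1) ≤ HLD q s h ((N + 2) * k + N) D y := by
  induction k with
  | zero => simp
  | succ k ih =>
    have hmin : 0 ≤ min y 1 := le_min hy zero_le_one
    have hH : 0 ≤ HLD q s h N D y := HLD_nonneg q s h N D hy
    have hcat := mul_HLD_le q s h (n₁ := (N + 2) * k + N) (chainLen_mod_two hN k) N D hy
    rw [show (N + 2) * k + N + (2 + N) = (N + 2) * (k + 1) + N by ring] at hcat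
    calc min y 1 ^ (k + 1) * HLD q s h N D y ^ (k + 1 + 1)
        = min y 1 * (min y 1 ^ k * HLD q s h N D y ^ (k + 1)) * HLD q s h N D y := by ring
      _ ≤ min y 1 * HLD q s h ((N + 2) * k + N) D y * HLD q s h N D y :=
          mul_le_mul_of_nonneg_right (mul_le_mul_of_nonneg_left ih hmin) hH
      _ = min y 1 * (HLD q s h ((N + 2) * k + N) D y * HLD q s h N D y) := by ring
      _ ≤ HLD q s h ((N + 2) * (k + 1) + N) D y := hcat

/-! ### Embedding the canonical class into the strip `S_T` by a glide reflection -/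

/-- The starting site `((h+1) mod 2, h)` of the embedded loops: in the cross-section `{0,1} × {0,…,T}`, with
`c + h` odd for `c = (h+1) mod 2`. [cite: MadrasSlade1993, §8.2, eq. (8.2.1) (the cross-section of the strip); BeatonBousquetMelouDeGierDuminilCopinGuttmann2014, §3.2 (arXiv v5 p. 10)] -/
def lstart (h : ℤ) : Site 2 := fun j => if j = 0 then (h + 1) % 2 else h

/-- Abscissa of `lstart h`. [cite: MadrasSlade1993, §8.2, eq. (8.2.1)] -/
@[simp] theorem lstart_apply_zero (h : ℤ) : lstart h 0 = (h + 1) % 2 := rfl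

/-- Ordinate of `lstart h`. [cite: MadrasSlade1993, §8.2, eq. (8.2.1)] -/
@[simp] theorem lstart_apply_one (h : ℤ) : lstart h 1 = h := by simp [lstart]

/-- `lstart h ∈ stripStarts T` for `0 ≤ h ≤ T`. [cite: MadrasSlade1993, §8.2, eq. (8.2.1)] -/
theorem lstart_mem_stripStarts {T : ℕ} {h : ℤ} (h0 : 0 ≤ h) (hT : h ≤ T) : lstart h ∈ stripStarts T :=
  mem_stripStarts.2 ⟨⟨by rw [lstart_apply_zero]; omega, by rw [lstart_apply_zero]; omega⟩,
    ⟨by rw [lstart_apply_one]; exact h0, by rw [lstart_apply_one]; exact hT⟩⟩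

/-- **The glide reflection `(X,Y) ↦ lstart h + (X, -Y)` is a brick-wall map** (its translation part has odd
coordinate sum). [cite: EntingJensen2009, §7.4.2, Fig. 7.10 (brickwork form of the honeycomb lattice)] -/
theorem isBW_lstart_add_negY {N : ℕ} {ω : ℕ → Site 2} (h : ℤ) (hbw : IsBW N ω) :
    IsBW N (fun i => lstart h + negY (ω i)) := by
  intro i hi
  have := hbw i hi
  simp only [brickWallGraph_adj_coord, Pi.add_apply, negY_apply_zero, negY_apply_one, lstart_apply_zero,
    lstart_apply_one] at this ⊢
  omega

/-- **A loop of the canonical class below level `h`, of depth `≤ D` with `h + D ≤ T`, embeds in `S_T`.**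
[cite: BeatonBousquetMelouDeGierDuminilCopinGuttmann2014, Proposition 7 (arXiv v5 p. 11: walks of the surface model placed in the strip); MadrasSlade1993, §8.2] -/
theorem emb_mem_stripPairs {T N D : ℕ} {h : ℤ} {ω : ℕ → Site 2} (hω : ω ∈ lpsD 1 h N D)
    (hT : h + D ≤ (T : ℤ)) : (lstart h, fun i => negY (ω i)) ∈ stripPairs T N := by
  obtain ⟨hωE, hdep⟩ := mem_lpsD.1 hω
  obtain ⟨hωb, -⟩ := mem_fbrE.1 hωE
  obtain ⟨hωf, -⟩ := mem_fbr.1 hωb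
  obtain ⟨hωs, hreg⟩ := mem_fcls.1 hωf
  obtain ⟨h0, -, hbw, -⟩ := mem_saws_iff.1 hωs
  have h0h : 0 ≤ h := by have := hreg 0 (Nat.zero_le _); rw [h0] at this; simpa using this
  refine mem_stripPairs.2 ⟨lstart_mem_stripStarts h0h (by omega), negY_comp_mem_saws hωs,
    isBW_lstart_add_negY h hbw, fun m hm => ?_⟩
  have h1 := hreg m hm
  have h2 := hdep m hm
  refine ⟨?_, ?_⟩ <;> simp only [Pi.add_apply, lstart_apply_one, negY_apply_one] <;> omega

/-- **Parity bookkeeping**: the printed level-`0` vertices (bottom row, ODD abscissa) of the embedded loop are the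
images of its EVEN-time visits to the line `Y = h`, plus the starting vertex when `h = 0`
(`X_m ≡ m - h (mod 2)` at such a visit, so `X_m + (h+1) ≡ m + 1`).
[cite: BeatonBousquetMelouDeGierDuminilCopinGuttmann2014, §3.2 (arXiv v5 p. 10: bc(ω), contacts with the bottom of the strip); EntingJensen2009, §7.4.2, Fig. 7.10 (brickwork form of the honeycomb lattice: its rows)] -/
theorem bottomVisits₀_emb {N : ℕ} {ω : ℕ → Site 2} (hω : ω ∈ saws N) (h : ℤ) :
    bottomVisits₀ (lstart h) (fun i => negY (ω i)) N = visitsAt 0 1 h N ω + (if h = 0 then 1 else 0) := by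
  obtain ⟨h0, -, -, -⟩ := mem_saws_iff.1 hω
  have h01 : ω 0 1 = 0 := by rw [h0]; rfl
  have hterm : ∀ m ≤ N, ((lstart h + negY (ω m)) 1 = 0 ∧ (lstart h + negY (ω m)) 0 % 2 = 1) ↔
      (m % 2 = 0 ∧ 1 * ω m 1 = h) := by
    intro m hm
    have hpar := parity_apply hω hm
    simp only [Pi.add_apply, lstart_apply_zero, lstart_apply_one, negY_apply_zero, negY_apply_one]
    constructor
    · rintro ⟨h1, h2⟩; exact ⟨by omega, by omega⟩
    · rintro ⟨h1, h2⟩; exact ⟨by omega, by omega⟩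
  unfold bottomVisits₀
  dsimp only
  rw [Finset.sum_range_succ', visitsAt_eq_sum]
  congr 1
  · refine Finset.sum_congr rfl fun j hj => ?_
    have hj' : j + 1 ≤ N := by have := Finset.mem_range.1 hj; omega
    have e := hterm (j + 1) hj'
    by_cases hc : (j + 1) % 2 = 0 ∧ 1 * ω (j + 1) 1 = h
    · rw [if_pos hc, if_pos (e.2 hc)]
    · rw [if_neg hc, if_neg (mt e.1 hc)]
  · have e := hterm 0 (Nat.zero_le _)
    by_cases hh : h = 0
    · rw [if_pos hh, if_pos (e.2 ⟨Nat.zero_mod 2, by rw [h01, hh]; ring⟩)]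
    · rw [if_neg hh, if_neg (fun hc => hh (by have := (e.1 hc).2; rw [h01] at this; omega))]

/-- **The canonical loop class embeds in the strip with its weight**: `min(y,1) · HLD 0 1 h N D y ≤ C_{T,N}(y,1)` for
`h + D ≤ T` (`y ≥ 0`). [cite: BeatonBousquetMelouDeGierDuminilCopinGuttmann2014, Proposition 7 (arXiv v5 p. 11: proof); HammersleyTorrieWhittington1982, §2] -/
theorem mul_HLD_le_stripZ₀ {T N D : ℕ} {h : ℤ} (hT : h + D ≤ (T : ℤ)) (hy : 0 ≤ y) :
    min y 1 * HLD 0 1 h N D y ≤ stripZ₀ T N y := by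
  classical
  have hinj : Set.InjOn (fun ω : ℕ → Site 2 => ((lstart h : Site 2), fun i => negY (ω i))) ↑(lpsD 1 h N D) := by
    intro ω _ ω' _ hh
    have h2 := congrArg Prod.snd hh
    funext i
    exact negY_injective (congrFun h2 i)
  calc min y 1 * HLD 0 1 h N D y = ∑ ω ∈ lpsD 1 h N D, min y 1 * y ^ visitsAt 0 1 h N ω := by
        rw [HLD, Finset.mul_sum]
    _ ≤ ∑ ω ∈ lpsD 1 h N D, y ^ bottomVisits₀ (lstart h) (fun i => negY (ω i)) N := by
        refine Finset.sum_le_sum fun ω hω => ?_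
        rw [bottomVisits₀_emb (saws_of_mem_lpsD hω) h]
        refine min_mul_pow_le hy (Nat.le_add_right _ _) ?_
        split_ifs <;> omega
    _ = ∑ p ∈ (lpsD 1 h N D).image (fun ω : ℕ → Site 2 => ((lstart h : Site 2), fun i => negY (ω i))),
          y ^ bottomVisits₀ p.1 p.2 N :=
        (Finset.sum_image (f := fun p : Site 2 × (ℕ → Site 2) => y ^ bottomVisits₀ p.1 p.2 N) hinj).symm
    _ ≤ stripZ₀ T N y := Finset.sum_le_sum_of_subset_of_nonneg (fun p hp => by
        obtain ⟨ω, hω, rfl⟩ := Finset.mem_image.1 hp; exact emb_mem_stripPairs hω hT) fun _ _ _ => pow_nonneg hy _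

/-! ### The limit along chains, and the rate -/

/-- **`(min(y,1) · HLD 0 1 h N D y)^{1/(N+2)} ≤ μ_T(y,1)` for `N` even and `h + D ≤ T`**: chains of `k+1` loops have
length `(N+2)k + N → ∞` and stay at depth `≤ D`; `C_{T,n}(y,1)^{1/n} → μ_T(y,1)`.
[cite: BeatonBousquetMelouDeGierDuminilCopinGuttmann2014, Propositions 6–7 (arXiv v5 pp. 10–12); HammersleyTorrieWhittington1982, §2 (2.7)–(2.9)] -/
theorem rpow_HLD_le_stripMuY₀ (hy : 0 < y) {N D T : ℕ} (hN : N % 2 = 0) {h : ℤ} (hT : h + D ≤ (T : ℤ)) :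
    (min y 1 * HLD 0 1 h N D y) ^ (1 / ((N : ℝ) + 2)) ≤ stripMuY₀ T y := by
  have hmin : 0 ≤ min y 1 := le_min hy.le zero_le_one
  have hW0 : 0 ≤ min y 1 * HLD 0 1 h N D y := mul_nonneg hmin (HLD_nonneg 0 1 h N D hy.le)
  have hpow : ∀ k : ℕ, (min y 1 * HLD 0 1 h N D y) ^ (k + 1) ≤ stripZ₀ T ((N + 2) * k + N) y := fun k => by
    have h1 := pow_mul_HLD_pow_le 0 1 h hN D hy.le k
    have h2 := mul_HLD_le_stripZ₀ (N := (N + 2) * k + N) (D := D) (h := h) (y := y) hT hy.le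
    calc (min y 1 * HLD 0 1 h N D y) ^ (k + 1)
        = min y 1 * (min y 1 ^ k * HLD 0 1 h N D y ^ (k + 1)) := by ring
      _ ≤ min y 1 * HLD 0 1 h ((N + 2) * k + N) D y := mul_le_mul_of_nonneg_left h1 hmin
      _ ≤ stripZ₀ T ((N + 2) * k + N) y := h2
  have hsub : Tendsto (fun k : ℕ => (N + 2) * k + N) atTop atTop := by
    refine Filter.tendsto_atTop_mono (fun k => ?_) tendsto_id
    show k ≤ (N + 2) * k + N
    nlinarith
  have hZ : Tendsto (fun k : ℕ => stripZ₀ T ((N + 2) * k + N) y ^ (1 / (((N + 2) * k + N : ℕ) : ℝ))) atTop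
      (𝓝 (stripMuY₀ T y)) := (tendsto_stripZ₀_rpow T hy).comp hsub
  have he : Tendsto (fun k : ℕ => ((k : ℝ) + 1) * (1 / (((N + 2) * k + N : ℕ) : ℝ))) atTop
      (𝓝 (1 / ((N : ℝ) + 2))) := by
    have h1 : Tendsto (fun k : ℕ => ((N : ℝ) + 2) - 2 * (1 / ((k : ℝ) + 1))) atTop
        (𝓝 (((N : ℝ) + 2) - 2 * 0)) :=
      tendsto_const_nhds.sub (tendsto_const_nhds.mul tendsto_one_div_add_atTop_nhds_zero_nat)
    rw [mul_zero, sub_zero] at h1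
    have h2 := h1.inv₀ (by positivity : ((N : ℝ) + 2) ≠ 0)
    rw [← one_div] at h2
    refine h2.congr' ?_
    filter_upwards [Filter.eventually_ge_atTop 1] with k hk
    have hk1 : ((k : ℝ) + 1) ≠ 0 := by positivity
    have hN' : (((N + 2) * k + N : ℕ) : ℝ) ≠ 0 := by
      have : 0 < (N + 2) * k + N := by nlinarith
      positivity
    refine inv_eq_of_mul_eq_one_right ?_
    field_simp
    push_cast
    ring
  have hg : Tendsto (fun k : ℕ => (min y 1 * HLD 0 1 h N D y) ^ (((k : ℝ) + 1) * (1 / (((N + 2) * k + N : ℕ) : ℝ))))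
      atTop (𝓝 ((min y 1 * HLD 0 1 h N D y) ^ (1 / ((N : ℝ) + 2)))) :=
    ((Real.continuousAt_const_rpow' (a := min y 1 * HLD 0 1 h N D y)
      (by positivity : (1 / ((N : ℝ) + 2)) ≠ 0)).tendsto).comp he
  refine le_of_tendsto_of_tendsto' hg hZ fun k => ?_
  show (min y 1 * HLD 0 1 h N D y) ^ (((k : ℝ) + 1) * (1 / (((N + 2) * k + N : ℕ) : ℝ))) ≤ _
  rw [Real.rpow_mul hW0, ← Nat.cast_add_one, Real.rpow_natCast]
  exact Real.rpow_le_rpow (pow_nonneg hW0 _) (hpow k) (by positivity)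

/-- **The strip-locality rate at every fugacity.**  For every `y > 0`, every `j` and every `T ≥ 6j+3`,
`log μ(y) - log μ_T(y,1) ≤ (4 log μ(y) - 2 log min(y,1) + 2 (6 √(2j) + log(2·2j+1))) / (4j+4)`:
an explicit `O(1/√T)` rate, valid in the adsorbed phase as well (the free-start most-popular class of Part A,
unfolded (B1), closed into loops (B2), chained and reflected into `S_T` (this file)).
[cite: BeatonBousquetMelouDeGierDuminilCopinGuttmann2014, Proposition 7 (arXiv v5 pp. 11–12: μ_T(y) → μ(y), no rate); JansevanRensburg2000, §5.4 (1st ed. pp. 167–170); HammersleyTorrieWhittington1982, §2; HammersleyWelsh1962, Theorem] -/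
theorem log_surfaceMu_sub_log_stripMuY₀_le (hy : 0 < y) (j : ℕ) {T : ℕ} (hT : 6 * j + 3 ≤ T) :
    Real.log (HV.surfaceMu y) - Real.log (stripMuY₀ T y) ≤
      (4 * Real.log (HV.surfaceMu y) - 2 * Real.log (min y 1) +
        2 * (6 * Real.sqrt (2 * j : ℕ) + Real.log (2 * (2 * j : ℕ) + 1))) / (4 * j + 4) := by
  have hμ0 : 0 < HV.surfaceMu y := HV.surfaceMu_pos y
  have hm0 : 0 < min y 1 := lt_min hy one_pos
  have hE0 : 0 < Real.exp (6 * Real.sqrt (2 * j : ℕ)) * (2 * (2 * j : ℕ) + 1) := by positivity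
  have hlogE : Real.log (Real.exp (6 * Real.sqrt (2 * j : ℕ)) * (2 * (2 * j : ℕ) + 1)) =
      6 * Real.sqrt (2 * j : ℕ) + Real.log (2 * (2 * j : ℕ) + 1) := by
    rw [Real.log_mul (Real.exp_pos _).ne' (by positivity), Real.log_exp]
  obtain ⟨h, h0, h1, hle⟩ := exists_pow_le_HBE_zero hy j
  set E := Real.exp (6 * Real.sqrt (2 * j : ℕ)) * (2 * (2 * j : ℕ) + 1) with hE
  set N := 2 * j + (2 + 2 * j) with hN
  have hNe : N % 2 = 0 := by omega
  set W := min y 1 * HLD 0 1 h N N y with hWdef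
  -- the canonical loop class carries the rate
  have hHL := HBE_zero_le_HLD 0 (Or.inl rfl) h N hy.le
  have hW : min y 1 * (min y 1 * (HV.surfaceMu y ^ (2 * j) * HV.surfaceMu y ^ (2 * j))) ≤ E ^ 2 * W :=
    calc min y 1 * (min y 1 * (HV.surfaceMu y ^ (2 * j) * HV.surfaceMu y ^ (2 * j)))
        ≤ min y 1 * (E ^ 2 * HBE 0 1 h N 0 y) := mul_le_mul_of_nonneg_left hle hm0.le
      _ = E ^ 2 * (min y 1 * HBE 0 1 h N 0 y) := by ring
      _ ≤ E ^ 2 * W := mul_le_mul_of_nonneg_left (mul_le_mul_of_nonneg_left hHL hm0.le) (sq_nonneg _)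
  have hL0 : 0 < min y 1 * (min y 1 * (HV.surfaceMu y ^ (2 * j) * HV.surfaceMu y ^ (2 * j))) :=
    mul_pos hm0 (mul_pos hm0 (mul_pos (pow_pos hμ0 _) (pow_pos hμ0 _)))
  have hW0 : 0 < W := pos_of_mul_pos_right (hL0.trans_le hW) (sq_nonneg _)
  -- logarithms
  have hb : 2 * Real.log (min y 1) + 4 * j * Real.log (HV.surfaceMu y) ≤ 2 * Real.log E + Real.log W := by
    have := Real.log_le_log hL0 hW
    rw [Real.log_mul hm0.ne' (mul_pos hm0 (mul_pos (pow_pos hμ0 _) (pow_pos hμ0 _))).ne',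
      Real.log_mul hm0.ne' (mul_pos (pow_pos hμ0 _) (pow_pos hμ0 _)).ne', ← pow_add, Real.log_pow,
      Real.log_mul (pow_pos hE0 2).ne' hW0.ne', Real.log_pow] at this
    push_cast at this
    linarith
  -- the strip bound
  have hμT : W ^ (1 / ((N : ℝ) + 2)) ≤ stripMuY₀ T y := rpow_HLD_le_stripMuY₀ hy hNe (D := N) (h := h) (by omega)
  have hN4 : ((N : ℝ) + 2) = 4 * (j : ℝ) + 4 := by rw [hN]; push_cast; ring
  have ha : Real.log W ≤ Real.log (stripMuY₀ T y) * (4 * j + 4) := by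
    have := Real.log_le_log (Real.rpow_pos_of_pos hW0 _) hμT
    rw [Real.log_rpow hW0, hN4, one_div_mul_eq_div, div_le_iff₀ (by positivity)] at this
    exact this
  rw [le_div_iff₀ (by positivity), ← hlogE]
  linarith

/-- **Two-sided strip locality with an explicit rate, at every fugacity**: for `y > 0`, every `j` and `T ≥ 6j+3`,
`|log μ(y) - log μ_T(y,1)| ≤ (4 log μ(y) - 2 log min(y,1) + 2 (6 √(2j) + log(2·2j+1))) / (4j+4)`
(the sign `μ_T(y,1) ≤ μ(y)` is lossless: `stripMuY₀_le_surfaceMu`).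
[cite: BeatonBousquetMelouDeGierDuminilCopinGuttmann2014, Proposition 7 (arXiv v5 pp. 11–12: μ_T(y) → μ(y), no rate); JansevanRensburg2000, §5.4 (1st ed. pp. 167–170); HammersleyTorrieWhittington1982, §2; HammersleyWelsh1962, Theorem] -/
theorem abs_log_surfaceMu_sub_log_stripMuY₀_le (hy : 0 < y) (j : ℕ) {T : ℕ} (hT : 6 * j + 3 ≤ T) :
    |Real.log (HV.surfaceMu y) - Real.log (stripMuY₀ T y)| ≤
      (4 * Real.log (HV.surfaceMu y) - 2 * Real.log (min y 1) +
        2 * (6 * Real.sqrt (2 * j : ℕ) + Real.log (2 * (2 * j : ℕ) + 1))) / (4 * j + 4) := by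
  rw [abs_of_nonneg (sub_nonneg.2 (Real.log_le_log (stripMuY₀_pos T hy) (stripMuY₀_le_surfaceMu T hy)))]
  exact log_surfaceMu_sub_log_stripMuY₀_le hy j hT

/-! ## Certified enclosure of `μ(y)` from one finite strip

Solving the rate inequality for `log μ(y)` turns it into a **closed-form upper bound on the surface growth
rate in terms of the finite-strip quantity `μ_T(y,1)` alone** (a transfer-matrix eigenvalue, computable for
each `T`); the matching lower bound `μ_T(y,1) ≤ μ(y)` is `stripMuY₀_le_surfaceMu` (S7). -/

/-- **`log μ(y)` bounded by finite-strip data**: for `y > 0`, `j ≥ 1` and `T ≥ 6j+3`,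
`log μ(y) ≤ ((j+1) · log μ_T(y,1) + (−2 log min(y,1) + 2 (6 √(2j) + log(2·2j+1)))/4) / j`.
[cite: BeatonBousquetMelouDeGierDuminilCopinGuttmann2014, §3.2 (the strip S_T and its transfer matrices), Proposition 7 (arXiv v5 pp. 11–12); JansevanRensburg2000, §5.4 (1st ed. pp. 167–170); HammersleyWelsh1962, Theorem] -/
theorem log_surfaceMu_le_of_strip (hy : 0 < y) {j : ℕ} (hj : 1 ≤ j) {T : ℕ} (hT : 6 * j + 3 ≤ T) :
    Real.log (HV.surfaceMu y) ≤
      (((j : ℝ) + 1) * Real.log (stripMuY₀ T y) +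
        (-2 * Real.log (min y 1) + 2 * (6 * Real.sqrt (2 * j : ℕ) + Real.log (2 * (2 * j : ℕ) + 1))) / 4) / j := by
  have h := log_surfaceMu_sub_log_stripMuY₀_le hy j hT
  have hj' : (1 : ℝ) ≤ j := by exact_mod_cast hj
  rw [le_div_iff₀ (by positivity)] at h
  rw [le_div_iff₀ (by positivity)]
  linarith

/-- **`μ(y) ≤ μ_T(y,1)^{(j+1)/j} · exp((−2 log min(y,1) + 2 (6 √(2j) + log(2·2j+1))) / (4j))`** for `y > 0`,
`j ≥ 1`, `T ≥ 6j+3`: the exponentiated form — an explicit, certified upper bound on the surface growth rate at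
every fugacity from one strip. [cite: BeatonBousquetMelouDeGierDuminilCopinGuttmann2014, §3.2, Proposition 7 (arXiv v5 pp. 11–12); JansevanRensburg2000, §5.4 (1st ed. pp. 167–170); HammersleyWelsh1962, Theorem] -/
theorem surfaceMu_le_stripMuY₀_rpow_mul_exp (hy : 0 < y) {j : ℕ} (hj : 1 ≤ j) {T : ℕ} (hT : 6 * j + 3 ≤ T) :
    HV.surfaceMu y ≤ stripMuY₀ T y ^ (((j : ℝ) + 1) / j) *
      Real.exp ((-2 * Real.log (min y 1) +
        2 * (6 * Real.sqrt (2 * j : ℕ) + Real.log (2 * (2 * j : ℕ) + 1))) / (4 * j)) := by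
  have hμ0 : 0 < HV.surfaceMu y := HV.surfaceMu_pos y
  have hT0 : 0 < stripMuY₀ T y := stripMuY₀_pos T hy
  have hj0 : (0 : ℝ) < j := by exact_mod_cast hj
  have h := log_surfaceMu_le_of_strip hy hj hT
  rw [← Real.log_le_log_iff hμ0 (by positivity), Real.log_mul (by positivity) (Real.exp_pos _).ne',
    Real.log_rpow hT0, Real.log_exp]
  have hre : (((j : ℝ) + 1) * Real.log (stripMuY₀ T y) +
      (-2 * Real.log (min y 1) + 2 * (6 * Real.sqrt (2 * j : ℕ) + Real.log (2 * (2 * j : ℕ) + 1))) / 4) / j =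
      ((j : ℝ) + 1) / j * Real.log (stripMuY₀ T y) + (-2 * Real.log (min y 1) +
        2 * (6 * Real.sqrt (2 * j : ℕ) + Real.log (2 * (2 * j : ℕ) + 1))) / (4 * j) := by
    field_simp
  rwa [hre] at h

/-- **Strip-indexed form** (`j := ⌊(T-3)/6⌋`): for `y > 0` and `T ≥ 9`,
`log μ(y) ≤ ((j+1) · log μ_T(y,1) + (−2 log min(y,1) + 2 (6 √(2j) + log(2·2j+1)))/4) / j` with `j = (T-3)/6`.
[cite: BeatonBousquetMelouDeGierDuminilCopinGuttmann2014, §3.2, Proposition 7 (arXiv v5 pp. 11–12); HammersleyWelsh1962, Theorem] -/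
theorem log_surfaceMu_le_of_strip' (hy : 0 < y) {T : ℕ} (hT : 9 ≤ T) :
    Real.log (HV.surfaceMu y) ≤
      (((((T - 3) / 6 : ℕ) : ℝ) + 1) * Real.log (stripMuY₀ T y) +
        (-2 * Real.log (min y 1) + 2 * (6 * Real.sqrt (2 * ((T - 3) / 6) : ℕ) +
          Real.log (2 * (2 * ((T - 3) / 6) : ℕ) + 1))) / 4) / ((T - 3) / 6 : ℕ) :=
  log_surfaceMu_le_of_strip hy (j := (T - 3) / 6) (by omega) (by omega)

/-! ## Part D — The surface growth rate enclosed by finite-length enumeration data, with an explicit Hammersley–Welsh rate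
(code of HOME car 19 `HexSAWSurfaceFreeStartRate_ed1_e0a4a212147c22b8.lean`, sha16 `e0a4a212147c22b8`)

Part A's free-start maximum `Ĥ_n(y) = Hhat 0 1 n y` is FINITE ENUMERATION DATA, and Fekete gives `μ(y)^{2j} ≤ Ĥ_{2j}(y)`
with no loss (`surfaceMu_pow_le_Hhat`).  Here the matching UPPER bound with an explicit unfolding rate:

* `mul_HBE_le_pow` — every pinned free-start bridge class of length `2j` satisfies
  `min(y,1) · HBE 0 1 h (2j) e y ≤ μ(y)^{2j+2}` (mirror loops (B2) ⊆ loops of depth `≤ N` (C), chained and embedded in the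
  strip `S_{h+N}` (`rpow_HLD_le_stripMuY₀`), and `μ_T(y,1) ≤ μ(y)` (S7));
* `HF_le_exp_mul_pow`, **`Hhat_le_exp_mul_pow`** — `Ĥ_{2j}(y) ≤ e^{6√(2j)} (2·2j+1) μ(y)^{2j+2} / min(y,1)`;
* **`abs_log_Hhat_div_sub_log_surfaceMu_le`** — `|log Ĥ_{2j}(y) / (2j) - log μ(y)| ≤ (6√(2j) + log(2·2j+1) + 2 log μ(y) - log min(y,1)) / (2j)`
  (`j ≥ 1`);
* **`log_surfaceMu_le_log_Hhat_div`**, **`div_le_log_surfaceMu`**, **`surfaceMu_le_Hhat_rpow`**, **`rpow_le_surfaceMu`** —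
  `(Ĥ_{2j}(y) · min(y,1) / (e^{6√(2j)} (2·2j+1)))^{1/(2j+2)} ≤ μ(y) ≤ Ĥ_{2j}(y)^{1/(2j)}`.
-/

/-- **Every pinned free-start bridge class is dominated by the growth rate**: for `y > 0`, `h ≥ 0`, every `j`
and every end ordinate `e`, `min(y,1) · HBE 0 1 h (2j) e y ≤ μ(y)^{2j+2}` (two members mirror-join to a loop
(B2), loops chain inside the strip `S_{h+N}` (C) and `μ_T(y,1) ≤ μ(y)` (S7)).
[cite: HammersleyTorrieWhittington1982, §2; JansevanRensburg2000, §5.4 (1st ed. pp. 167–170); BeatonBousquetMelouDeGierDuminilCopinGuttmann2014, Proposition 7 (arXiv v5 pp. 11–12)] -/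
theorem mul_HBE_le_pow (hy : 0 < y) {h : ℤ} (h0 : 0 ≤ h) (j : ℕ) (e : ℤ) :
    min y 1 * HBE 0 1 h (2 * j) e y ≤ HV.surfaceMu y ^ (2 * j + 2) := by
  have hμ0 : 0 < HV.surfaceMu y := HV.surfaceMu_pos y
  have hm0 : 0 < min y 1 := lt_min hy one_pos
  set N := 2 * j + (2 + 2 * j) with hN
  have hNe : N % 2 = 0 := by omega
  -- mirror loops, then all loops of depth ≤ N
  have h1 : min y 1 * HBE 0 1 h (2 * j) e y ^ 2 ≤ HBE 0 1 h N 0 y := mul_HBE_sq_le 0 1 h e (by omega) hy.le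
  have h2 : HBE 0 1 h N 0 y ≤ HLD 0 1 h N N y := HBE_zero_le_HLD 0 (Or.inl rfl) h N hy.le
  set W := min y 1 * HLD 0 1 h N N y with hW
  have hW0 : 0 ≤ W := mul_nonneg hm0.le (HLD_nonneg 0 1 h N N hy.le)
  -- the strip of height h + N, then S7
  set T : ℕ := h.toNat + N with hT
  have hhT : h + (N : ℤ) ≤ (T : ℤ) := by rw [hT]; push_cast; rw [Int.toNat_of_nonneg h0]
  have h3 : W ^ (1 / ((N : ℝ) + 2)) ≤ HV.surfaceMu y :=
    (rpow_HLD_le_stripMuY₀ hy hNe (D := N) (h := h) hhT).trans (stripMuY₀_le_surfaceMu T hy)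
  have h4 : W ≤ HV.surfaceMu y ^ (N + 2) := by
    have hexp : (1 / ((N : ℝ) + 2)) = ((N + 2 : ℕ) : ℝ)⁻¹ := by push_cast; rw [one_div]
    have := pow_le_pow_left₀ (Real.rpow_nonneg hW0 _) h3 (N + 2)
    rwa [hexp, Real.rpow_inv_natCast_pow hW0 (by omega)] at this
  -- squares
  have h5 : (min y 1 * HBE 0 1 h (2 * j) e y) ^ 2 ≤ (HV.surfaceMu y ^ (2 * j + 2)) ^ 2 :=
    calc (min y 1 * HBE 0 1 h (2 * j) e y) ^ 2 = min y 1 * (min y 1 * HBE 0 1 h (2 * j) e y ^ 2) := by ring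
      _ ≤ min y 1 * HBE 0 1 h N 0 y := mul_le_mul_of_nonneg_left h1 hm0.le
      _ ≤ W := mul_le_mul_of_nonneg_left h2 hm0.le
      _ ≤ HV.surfaceMu y ^ (N + 2) := h4
      _ = (HV.surfaceMu y ^ (2 * j + 2)) ^ 2 := by rw [hN, ← pow_mul]; congr 1; ring
  exact le_of_pow_le_pow_left₀ two_ne_zero (by positivity) h5

/-- **Unfolded**: for `y > 0`, `h ≥ 0` and every `j`,
`HF 0 1 h (2j) y ≤ e^{6√(2j)} (2·2j+1) · μ(y)^{2j+2} / min(y,1)` (Hammersley–Welsh unfolding to free-start bridges (B1),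
pigeonhole over the `2·2j+1` end ordinates, and `mul_HBE_le_pow`).
[cite: HammersleyWelsh1962, Theorem; MadrasSlade1993, §3.1, Theorem 3.1.1 (pp. 57–61); JansevanRensburg2000, §5.4 (1st ed. pp. 167–170)] -/
theorem HF_le_exp_mul_pow (hy : 0 < y) {h : ℤ} (h0 : 0 ≤ h) (j : ℕ) :
    HF 0 1 h (2 * j) y ≤
      Real.exp (6 * Real.sqrt (2 * j : ℕ)) * (2 * (2 * j : ℕ) + 1) * (HV.surfaceMu y ^ (2 * j + 2) / min y 1) := by
  have hm0 : 0 < min y 1 := lt_min hy one_pos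
  have hunf := HF_le_exp_mul_HB 0 1 h (n := 2 * j) (by omega) hy.le
  obtain ⟨e, -, hpig⟩ := HB_le_mul_HBE 0 1 h (2 * j) y
  have hcls : HBE 0 1 h (2 * j) e y ≤ HV.surfaceMu y ^ (2 * j + 2) / min y 1 := by
    rw [le_div_iff₀ hm0, mul_comm]
    exact mul_HBE_le_pow hy h0 j e
  calc HF 0 1 h (2 * j) y ≤ Real.exp (6 * Real.sqrt (2 * j : ℕ)) * HB 0 1 h (2 * j) y := hunf
    _ ≤ Real.exp (6 * Real.sqrt (2 * j : ℕ)) * ((2 * (2 * j : ℕ) + 1) * HBE 0 1 h (2 * j) e y) :=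
        mul_le_mul_of_nonneg_left hpig (Real.exp_pos _).le
    _ ≤ Real.exp (6 * Real.sqrt (2 * j : ℕ)) * ((2 * (2 * j : ℕ) + 1) * (HV.surfaceMu y ^ (2 * j + 2) / min y 1)) :=
        mul_le_mul_of_nonneg_left (mul_le_mul_of_nonneg_left hcls (by positivity)) (Real.exp_pos _).le
    _ = _ := by ring

/-- **The free-start maximum is dominated, with an explicit unfolding rate**: for `y > 0` and every `j`,
`Ĥ_{2j}(y) ≤ e^{6√(2j)} (2·2j+1) · μ(y)^{2j+2} / min(y,1)`.
[cite: HammersleyWelsh1962, Theorem; MadrasSlade1993, §3.1, Theorem 3.1.1 (pp. 57–61); JansevanRensburg2000, §5.4 (1st ed. pp. 167–170); HammersleyTorrieWhittington1982, §2] -/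
theorem Hhat_le_exp_mul_pow (hy : 0 < y) (j : ℕ) :
    Hhat 0 1 (2 * j) y ≤
      Real.exp (6 * Real.sqrt (2 * j : ℕ)) * (2 * (2 * j : ℕ) + 1) * (HV.surfaceMu y ^ (2 * j + 2) / min y 1) :=
  Hhat_le fun _ h0 _ => HF_le_exp_mul_pow hy h0 j

/-- The logarithmic form: `log Ĥ_{2j}(y) ≤ 6√(2j) + log(2·2j+1) + (2j+2) log μ(y) - log min(y,1)` (`y > 0`).
[cite: HammersleyWelsh1962, Theorem; JansevanRensburg2000, §5.4 (1st ed. pp. 167–170)] -/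
theorem log_Hhat_le (hy : 0 < y) (j : ℕ) :
    Real.log (Hhat 0 1 (2 * j) y) ≤ 6 * Real.sqrt (2 * j : ℕ) + Real.log (2 * (2 * j : ℕ) + 1) +
      (2 * j + 2) * Real.log (HV.surfaceMu y) - Real.log (min y 1) := by
  have hμ0 : 0 < HV.surfaceMu y := HV.surfaceMu_pos y
  have hm0 : 0 < min y 1 := lt_min hy one_pos
  have h := Real.log_le_log (Hhat_pos 0 (Or.inl rfl) (2 * j) y) (Hhat_le_exp_mul_pow hy j)
  rw [Real.log_mul (by positivity) (by positivity), Real.log_mul (Real.exp_pos _).ne' (by positivity),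
    Real.log_exp, Real.log_div (by positivity) hm0.ne', Real.log_pow] at h
  have hc : ((2 * j + 2 : ℕ) : ℝ) = 2 * (j : ℝ) + 2 := by push_cast; ring
  rw [hc] at h
  linarith

/-- **The explicit Hammersley–Welsh rate at every fugacity**: for `y > 0` and `j ≥ 1`,
`|log Ĥ_{2j}(y) / (2j) - log μ(y)| ≤ (6√(2j) + log(2·2j+1) + 2 log μ(y) - log min(y,1)) / (2j)` — the free energy
of the adsorbing surface model is computable from length-`2j` enumeration data with a certified `O(1/√j)` error,
in the adsorbed phase as well.
[cite: HammersleyWelsh1962, Theorem; MadrasSlade1993, §3.1, Theorem 3.1.1 (pp. 57–61); HammersleyTorrieWhittington1982, §2 (existence of the limit, no rate); JansevanRensburg2000, §5.4 (1st ed. pp. 167–170)] -/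
theorem abs_log_Hhat_div_sub_log_surfaceMu_le (hy : 0 < y) {j : ℕ} (hj : 1 ≤ j) :
    |Real.log (Hhat 0 1 (2 * j) y) / (2 * j) - Real.log (HV.surfaceMu y)| ≤
      (6 * Real.sqrt (2 * j : ℕ) + Real.log (2 * (2 * j : ℕ) + 1) + 2 * Real.log (HV.surfaceMu y) -
        Real.log (min y 1)) / (2 * j) := by
  have hμ0 : 0 < HV.surfaceMu y := HV.surfaceMu_pos y
  have hj0 : (0 : ℝ) < j := by exact_mod_cast hj
  have hlow : (2 * j : ℕ) * Real.log (HV.surfaceMu y) ≤ Real.log (Hhat 0 1 (2 * j) y) := by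
    rw [← Real.log_pow]
    exact Real.log_le_log (pow_pos hμ0 _) (surfaceMu_pow_le_Hhat hy j)
  push_cast at hlow
  have hup := log_Hhat_le hy j
  have hre : Real.log (Hhat 0 1 (2 * j) y) / (2 * j) - Real.log (HV.surfaceMu y) =
      (Real.log (Hhat 0 1 (2 * j) y) - 2 * j * Real.log (HV.surfaceMu y)) / (2 * j) := by
    field_simp
  rw [hre, abs_of_nonneg (div_nonneg (by linarith) (by positivity))]
  exact div_le_div_of_nonneg_right (by linarith) (by positivity)

/-! ## The enclosure of `μ(y)` by enumeration data -/

/-- Upper half (Fekete, no loss): `log μ(y) ≤ log Ĥ_{2j}(y) / (2j)` for `y > 0`, `j ≥ 1`.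
[cite: MadrasSlade1993, §1.2, Lemma 1.2.2 (pp. 8–9); HammersleyTorrieWhittington1982, §2] -/
theorem log_surfaceMu_le_log_Hhat_div (hy : 0 < y) {j : ℕ} (hj : 1 ≤ j) :
    Real.log (HV.surfaceMu y) ≤ Real.log (Hhat 0 1 (2 * j) y) / (2 * j) := by
  have hμ0 : 0 < HV.surfaceMu y := HV.surfaceMu_pos y
  have hj0 : (0 : ℝ) < j := by exact_mod_cast hj
  have hlow : (2 * j : ℕ) * Real.log (HV.surfaceMu y) ≤ Real.log (Hhat 0 1 (2 * j) y) := by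
    rw [← Real.log_pow]
    exact Real.log_le_log (pow_pos hμ0 _) (surfaceMu_pow_le_Hhat hy j)
  push_cast at hlow
  rw [le_div_iff₀ (by positivity)]
  linarith

/-- Lower half (unfolding, explicit): `(log Ĥ_{2j}(y) + log min(y,1) - 6√(2j) - log(2·2j+1)) / (2j+2) ≤ log μ(y)`
for `y > 0` and every `j`. [cite: HammersleyWelsh1962, Theorem; MadrasSlade1993, §3.1, Theorem 3.1.1 (pp. 57–61); JansevanRensburg2000, §5.4 (1st ed. pp. 167–170)] -/
theorem div_le_log_surfaceMu (hy : 0 < y) (j : ℕ) :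
    (Real.log (Hhat 0 1 (2 * j) y) + Real.log (min y 1) - 6 * Real.sqrt (2 * j : ℕ) -
        Real.log (2 * (2 * j : ℕ) + 1)) / (2 * j + 2) ≤ Real.log (HV.surfaceMu y) := by
  have hup := log_Hhat_le hy j
  rw [div_le_iff₀ (by positivity)]
  linarith

/-- **`μ(y) ≤ Ĥ_{2j}(y)^{1/(2j)}`** (`y > 0`, `j ≥ 1`). [cite: MadrasSlade1993, §1.2, Lemma 1.2.2 (pp. 8–9); HammersleyTorrieWhittington1982, §2] -/
theorem surfaceMu_le_Hhat_rpow (hy : 0 < y) {j : ℕ} (hj : 1 ≤ j) :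
    HV.surfaceMu y ≤ Hhat 0 1 (2 * j) y ^ (1 / (2 * j : ℝ)) := by
  have hμ0 : 0 < HV.surfaceMu y := HV.surfaceMu_pos y
  have hexp : (1 / (2 * j : ℝ)) = ((2 * j : ℕ) : ℝ)⁻¹ := by push_cast; rw [one_div]
  calc HV.surfaceMu y = (HV.surfaceMu y ^ (2 * j)) ^ (1 / (2 * j : ℝ)) := by
        rw [hexp, Real.pow_rpow_inv_natCast hμ0.le (by omega)]
    _ ≤ Hhat 0 1 (2 * j) y ^ (1 / (2 * j : ℝ)) :=
        Real.rpow_le_rpow (pow_nonneg hμ0.le _) (surfaceMu_pow_le_Hhat hy j) (by positivity)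

/-- **`(Ĥ_{2j}(y) · min(y,1) / (e^{6√(2j)} (2·2j+1)))^{1/(2j+2)} ≤ μ(y)`** (`y > 0`, every `j`): the explicit lower
half of the enclosure of the surface growth rate by length-`2j` enumeration data.
[cite: HammersleyWelsh1962, Theorem; MadrasSlade1993, §3.1, Theorem 3.1.1 (pp. 57–61); JansevanRensburg2000, §5.4 (1st ed. pp. 167–170); HammersleyTorrieWhittington1982, §2] -/
theorem rpow_le_surfaceMu (hy : 0 < y) (j : ℕ) :
    (Hhat 0 1 (2 * j) y * min y 1 / (Real.exp (6 * Real.sqrt (2 * j : ℕ)) * (2 * (2 * j : ℕ) + 1))) ^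
        (1 / ((2 * j : ℝ) + 2)) ≤ HV.surfaceMu y := by
  have hμ0 : 0 < HV.surfaceMu y := HV.surfaceMu_pos y
  have hm0 : 0 < min y 1 := lt_min hy one_pos
  have hE0 : 0 < Real.exp (6 * Real.sqrt (2 * j : ℕ)) * (2 * (2 * j : ℕ) + 1) := by positivity
  have hle : Hhat 0 1 (2 * j) y * min y 1 / (Real.exp (6 * Real.sqrt (2 * j : ℕ)) * (2 * (2 * j : ℕ) + 1)) ≤
      HV.surfaceMu y ^ (2 * j + 2) := by
    rw [div_le_iff₀ hE0]
    have h := Hhat_le_exp_mul_pow hy j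
    rw [← mul_div_assoc, le_div_iff₀ hm0] at h
    linarith
  have h0 : 0 ≤ Hhat 0 1 (2 * j) y * min y 1 / (Real.exp (6 * Real.sqrt (2 * j : ℕ)) * (2 * (2 * j : ℕ) + 1)) :=
    div_nonneg (mul_nonneg (Hhat_pos 0 (Or.inl rfl) (2 * j) y).le hm0.le) hE0.le
  have hexp : ((2 * j + 2 : ℕ) : ℝ) * (1 / ((2 * j : ℝ) + 2)) = 1 := by
    push_cast
    field_simp
  calc _ ≤ (HV.surfaceMu y ^ (2 * j + 2)) ^ (1 / ((2 * j : ℝ) + 2)) := Real.rpow_le_rpow h0 hle (by positivity)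
    _ = HV.surfaceMu y := by rw [← Real.rpow_natCast, ← Real.rpow_mul hμ0.le, hexp, Real.rpow_one]

/-! ## Part E — Uniform constants: `μ(y)` eliminated from the right-hand sides
(code of HOME car 20 `HexSAWSurfaceRateConstants_ed1_232b094f680d0ae8.lean`, sha16 `232b094f680d0ae8`)

Parts C and D bound `|log μ(y) - log μ_T(y,1)|` and `|log Ĥ_{2j}(y)/(2j) - log μ(y)|` by expressions that still contain
`log μ(y)` and `log min(y,1)`.  Two printed facts remove them: `μ = √(2+√2) ≤ 2` and `μ(y) ≤ √y · μ` for `y ≥ 1`,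
`μ(y) = μ` for `y ≤ 1 + √2` (Beaton et al., Proposition 5 and the remark after it), whence
`2 log μ(y) - log min(y,1) ≤ |log y| + 3/2` (`two_mul_log_surfaceMu_sub_log_min_le`).  Consequences, for every `y > 0`:
**`abs_log_surfaceMu_sub_log_stripMuY₀_le_of_nine_le`** (`T ≥ 9`: `≤ (14 √T + 4 log T + 4 |log y| + 6) / T`),
**`abs_log_surfaceMu_sub_log_stripMuY₀_le_div_sqrt`** (`≤ (22 + 2 |log y|) / √T`), **`surfaceMu_le_stripMuY₀_mul_exp`**,
**`surfaceMu_mem_Icc_stripMuY₀`**, **`abs_log_Hhat_div_sub_log_surfaceMu_le'`**.  The numerical constants `14, 4, 4, 6`,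
`22, 2` and `3/2` are bookkeeping (explicit, not optimal).
-/

/-- `μ = √(2+√2) ≤ 2` for the honeycomb connective constant. [cite: DuminilCopinSmirnov2012, Theorem 1] -/
theorem hexConnectiveConstant_le_two : hexConnectiveConstant ≤ 2 := by
  rw [hexConnectiveConstant_eq_of_thm1 DuminilCopinSmirnov2012_thm1_holds]
  have h2 : Real.sqrt 2 ≤ 2 := by nlinarith [Real.sq_sqrt (show (0 : ℝ) ≤ 2 by norm_num), Real.sqrt_nonneg 2]
  calc Real.sqrt (2 + Real.sqrt 2) ≤ Real.sqrt (2 ^ 2) := Real.sqrt_le_sqrt (by linarith)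
    _ = 2 := Real.sqrt_sq (by norm_num)

/-- `2 log μ ≤ 3/2` (from `μ ≤ 2` and `log 2 < 0.6931471808`). [cite: DuminilCopinSmirnov2012, Theorem 1] -/
theorem two_mul_log_hexConnectiveConstant_le : 2 * Real.log hexConnectiveConstant ≤ 3 / 2 := by
  have h := Real.log_le_log hexConnectiveConstant_pos hexConnectiveConstant_le_two
  have h2 := Real.log_two_lt_d9
  linarith

/-- **The a-priori bound that removes `μ(y)` from the rates**: for `y > 0`,
`2 log μ(y) - log min(y,1) ≤ |log y| + 3/2` (`y ≥ 1`: `μ(y) ≤ √y·μ`; `y ≤ 1`: `μ(y) = μ`; and `μ ≤ 2`).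
[cite: BeatonBousquetMelouDeGierDuminilCopinGuttmann2014, §3.1, Proposition 5 and the remark after it (arXiv v5 p. 9); DuminilCopinSmirnov2012, Theorem 1] -/
theorem two_mul_log_surfaceMu_sub_log_min_le (hy : 0 < y) :
    2 * Real.log (HV.surfaceMu y) - Real.log (min y 1) ≤ |Real.log y| + 3 / 2 := by
  have hμ := two_mul_log_hexConnectiveConstant_le
  have hμ0 : 0 < hexConnectiveConstant := hexConnectiveConstant_pos
  rcases le_total 1 y with hy1 | hy1
  · -- adsorbing side: μ(y) ≤ √y · μ
    have hmin : min y 1 = 1 := min_eq_right hy1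
    have h1 : HV.surfaceMu y ≤ Real.sqrt y * hexConnectiveConstant := HV.surfaceMu_le_sqrt_mul hy1
    have h2 : Real.log (HV.surfaceMu y) ≤ Real.log y / 2 + Real.log hexConnectiveConstant := by
      have := Real.log_le_log (HV.surfaceMu_pos y) h1
      rwa [Real.log_mul (Real.sqrt_pos.2 hy).ne' hμ0.ne', Real.log_sqrt hy.le] at this
    have h3 : |Real.log y| = Real.log y := abs_of_nonneg (Real.log_nonneg hy1)
    rw [hmin, Real.log_one, h3]
    linarith
  · -- desorbed side: μ(y) = μ
    have hmin : min y 1 = y := min_eq_left hy1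
    have h1 : HV.surfaceMu y = hexConnectiveConstant :=
      (HV.surfaceMu_eq_iff hy).2 (hy1.trans (by have := Real.sqrt_nonneg 2; linarith))
    have h3 : -Real.log y ≤ |Real.log y| := neg_le_abs _
    rw [hmin, h1]
    linarith

/-- **Strip locality of the surface growth rate with a `μ(y)`-free explicit rate**: for `y > 0` and every
strip height `T ≥ 9`, `|log μ(y) - log μ_T(y,1)| ≤ (14 √T + 4 log T + 4 |log y| + 6) / T`
(Part C at `j = ⌊(T-3)/6⌋`, then `two_mul_log_surfaceMu_sub_log_min_le`).
[cite: BeatonBousquetMelouDeGierDuminilCopinGuttmann2014, §3.2, Proposition 7 (arXiv v5 pp. 11–12: `μ_T(y) → μ(y)`, no rate); HammersleyWelsh1962, Theorem; HammersleyTorrieWhittington1982, §2] -/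
theorem abs_log_surfaceMu_sub_log_stripMuY₀_le_of_nine_le (hy : 0 < y) {T : ℕ} (hT : 9 ≤ T) :
    |Real.log (HV.surfaceMu y) - Real.log (stripMuY₀ T y)| ≤
      (14 * Real.sqrt T + 4 * Real.log T + 4 * |Real.log y| + 6) / T := by
  set j : ℕ := (T - 3) / 6 with hj
  have hjT : 6 * j + 3 ≤ T := by omega
  have h := abs_log_surfaceMu_sub_log_stripMuY₀_le hy j hjT
  have hA := two_mul_log_surfaceMu_sub_log_min_le hy
  have hT0 : (0 : ℝ) < T := by exact_mod_cast (show 0 < T by omega)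
  have hT9 : (9 : ℝ) ≤ T := by exact_mod_cast hT
  -- the square-root term: 12 √(2j) ≤ 7 √T, from 144·2j ≤ 49·T
  have h144 : Real.sqrt 144 = 12 := by rw [show (144 : ℝ) = 12 ^ 2 by norm_num, Real.sqrt_sq (by norm_num)]
  have h49 : Real.sqrt 49 = 7 := by rw [show (49 : ℝ) = 7 ^ 2 by norm_num, Real.sqrt_sq (by norm_num)]
  have hs : 12 * Real.sqrt (2 * j : ℕ) ≤ 7 * Real.sqrt T := by
    have hc : (144 : ℝ) * ((2 * j : ℕ) : ℝ) ≤ 49 * T := by exact_mod_cast (show 144 * (2 * j) ≤ 49 * T by omega)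
    rw [← h144, ← h49, ← Real.sqrt_mul (by norm_num), ← Real.sqrt_mul (by norm_num)]
    exact Real.sqrt_le_sqrt hc
  -- the logarithmic term: log (2·2j+1) ≤ log T
  have hl : Real.log (2 * (2 * j : ℕ) + 1) ≤ Real.log T := by
    have hc : (2 : ℝ) * ((2 * j : ℕ) : ℝ) + 1 ≤ T := by exact_mod_cast (show 2 * (2 * j) + 1 ≤ T by omega)
    exact Real.log_le_log (by positivity) hc
  -- the denominator: (2T - 4)/3 ≤ 4j + 4
  have hd : (2 * (T : ℝ) - 4) / 3 ≤ 4 * j + 4 := by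
    have hc : (2 : ℝ) * T ≤ 12 * (j : ℝ) + 16 := by exact_mod_cast (show 2 * T ≤ 12 * j + 16 by omega)
    linarith
  have hd0 : (0 : ℝ) < (2 * (T : ℝ) - 4) / 3 := by linarith
  set N' : ℝ := 7 * Real.sqrt T + 2 * Real.log T + 2 * |Real.log y| + 3 with hN'
  have hlogT : 0 ≤ Real.log T := Real.log_nonneg (by linarith)
  have hN'0 : 0 ≤ N' := by have := Real.sqrt_nonneg (T : ℝ); have := abs_nonneg (Real.log y); rw [hN']; positivity
  have hN : 4 * Real.log (HV.surfaceMu y) - 2 * Real.log (min y 1) +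
      2 * (6 * Real.sqrt (2 * j : ℕ) + Real.log (2 * (2 * j : ℕ) + 1)) ≤ N' := by rw [hN']; linarith
  calc |Real.log (HV.surfaceMu y) - Real.log (stripMuY₀ T y)|
      ≤ (4 * Real.log (HV.surfaceMu y) - 2 * Real.log (min y 1) +
          2 * (6 * Real.sqrt (2 * j : ℕ) + Real.log (2 * (2 * j : ℕ) + 1))) / (4 * j + 4) := h
    _ ≤ N' / (4 * j + 4) := div_le_div_of_nonneg_right hN (by positivity)
    _ ≤ N' / ((2 * (T : ℝ) - 4) / 3) := div_le_div_of_nonneg_left hN'0 hd0 hd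
    _ ≤ (14 * Real.sqrt T + 4 * Real.log T + 4 * |Real.log y| + 6) / T := by
      rw [div_le_div_iff₀ hd0 hT0, hN']
      nlinarith [mul_nonneg hN'0 (show (0 : ℝ) ≤ T - 8 by linarith)]

/-- **`O(1/√T)` form**: for `y > 0` and `T ≥ 9`, `|log μ(y) - log μ_T(y,1)| ≤ (22 + 2 |log y|) / √T`.
[cite: BeatonBousquetMelouDeGierDuminilCopinGuttmann2014, §3.2, Proposition 7 (arXiv v5 pp. 11–12); HammersleyWelsh1962, Theorem] -/
theorem abs_log_surfaceMu_sub_log_stripMuY₀_le_div_sqrt (hy : 0 < y) {T : ℕ} (hT : 9 ≤ T) :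
    |Real.log (HV.surfaceMu y) - Real.log (stripMuY₀ T y)| ≤ (22 + 2 * |Real.log y|) / Real.sqrt T := by
  have h := abs_log_surfaceMu_sub_log_stripMuY₀_le_of_nine_le hy hT
  have hT0 : (0 : ℝ) < T := by exact_mod_cast (show 0 < T by omega)
  have hT9 : (9 : ℝ) ≤ T := by exact_mod_cast hT
  set r := Real.sqrt T with hr
  have hrr : r * r = T := Real.mul_self_sqrt hT0.le
  have hr3 : 3 ≤ r := by
    rw [hr, show (3 : ℝ) = Real.sqrt (3 ^ 2) by rw [Real.sqrt_sq (by norm_num)]]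
    exact Real.sqrt_le_sqrt (by linarith)
  have hr0 : 0 < r := by linarith
  -- log T = 2 log √T ≤ 2 (√T - 1)
  have hlog : Real.log T ≤ 2 * r - 2 := by
    have h1 : Real.log r ≤ r - 1 := Real.log_le_sub_one_of_pos hr0
    have h2 : Real.log r = Real.log T / 2 := by rw [hr, Real.log_sqrt hT0.le]
    linarith
  have ha : 0 ≤ |Real.log y| := abs_nonneg _
  refine h.trans ?_
  rw [div_le_div_iff₀ hT0 hr0]
  nlinarith [mul_nonneg (mul_nonneg ha hr0.le) (show (0 : ℝ) ≤ r - 2 by linarith), mul_le_mul_of_nonneg_right hlog hr0.le]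

/-- **The strip enclosure with computable width**: for `y > 0` and `T ≥ 9`,
`μ(y) ≤ μ_T(y,1) · exp ((14 √T + 4 log T + 4 |log y| + 6) / T)`.
[cite: BeatonBousquetMelouDeGierDuminilCopinGuttmann2014, §3.2, Proposition 7 (arXiv v5 pp. 11–12); HammersleyWelsh1962, Theorem] -/
theorem surfaceMu_le_stripMuY₀_mul_exp (hy : 0 < y) {T : ℕ} (hT : 9 ≤ T) :
    HV.surfaceMu y ≤ stripMuY₀ T y * Real.exp ((14 * Real.sqrt T + 4 * Real.log T + 4 * |Real.log y| + 6) / T) := by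
  have h := (abs_le.1 (abs_log_surfaceMu_sub_log_stripMuY₀_le_of_nine_le hy hT)).2
  have hμ0 : 0 < HV.surfaceMu y := HV.surfaceMu_pos y
  have hs0 : 0 < stripMuY₀ T y := stripMuY₀_pos T hy
  calc HV.surfaceMu y = Real.exp (Real.log (HV.surfaceMu y)) := (Real.exp_log hμ0).symm
    _ ≤ Real.exp (Real.log (stripMuY₀ T y) + (14 * Real.sqrt T + 4 * Real.log T + 4 * |Real.log y| + 6) / T) :=
        Real.exp_le_exp.2 (by linarith)
    _ = stripMuY₀ T y * Real.exp ((14 * Real.sqrt T + 4 * Real.log T + 4 * |Real.log y| + 6) / T) := by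
        rw [Real.exp_add, Real.exp_log hs0]

/-- **`μ(y) ∈ [μ_T(y,1), μ_T(y,1) · e^{(14 √T + 4 log T + 4 |log y| + 6)/T}]`** for `y > 0`, `T ≥ 9`: ONE strip
(one transfer-matrix eigenvalue) encloses the surface growth rate at every fugacity with an explicit, computable
width (lower side `stripMuY₀_le_surfaceMu`, S7).
[cite: BeatonBousquetMelouDeGierDuminilCopinGuttmann2014, §3.2, Proposition 7 (arXiv v5 pp. 11–12); HammersleyTorrieWhittington1982, §2] -/
theorem surfaceMu_mem_Icc_stripMuY₀ (hy : 0 < y) {T : ℕ} (hT : 9 ≤ T) :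
    HV.surfaceMu y ∈ Set.Icc (stripMuY₀ T y)
      (stripMuY₀ T y * Real.exp ((14 * Real.sqrt T + 4 * Real.log T + 4 * |Real.log y| + 6) / T)) :=
  ⟨stripMuY₀_le_surfaceMu T hy, surfaceMu_le_stripMuY₀_mul_exp hy hT⟩

/-- **The Hammersley–Welsh rate with a `μ(y)`-free constant**: for `y > 0` and `j ≥ 1`,
`|log Ĥ_{2j}(y) / (2j) - log μ(y)| ≤ (6 √(2j) + log (2·2j+1) + |log y| + 3/2) / (2j)`.
[cite: HammersleyWelsh1962, Theorem; MadrasSlade1993, §3.1, Theorem 3.1.1 (pp. 57–61); HammersleyTorrieWhittington1982, §2] -/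
theorem abs_log_Hhat_div_sub_log_surfaceMu_le' (hy : 0 < y) {j : ℕ} (hj : 1 ≤ j) :
    |Real.log (Hhat 0 1 (2 * j) y) / (2 * j) - Real.log (HV.surfaceMu y)| ≤
      (6 * Real.sqrt (2 * j : ℕ) + Real.log (2 * (2 * j : ℕ) + 1) + |Real.log y| + 3 / 2) / (2 * j) := by
  have h := abs_log_Hhat_div_sub_log_surfaceMu_le hy hj
  have hA := two_mul_log_surfaceMu_sub_log_min_le hy
  have hj1 : (1 : ℝ) ≤ j := by exact_mod_cast hj
  have hj0 : (0 : ℝ) < 2 * j := by linarith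
  exact h.trans (div_le_div_of_nonneg_right (by linarith) hj0.le)

end Literature.Probability.RandomPlanarGeometry.SAW.HexBW.Wall
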